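import Literature.NumberTheory.EllipticCurves.PadicWeierstrassZetaApproximants
import Mathlib.AlgebraicGeometry.EllipticCurve.Affine.Point
import Mathlib.RingTheory.LaurentSeries
import Mathlib.RingTheory.HahnSeries.Summable
import Mathlib.Algebra.Polynomial.Roots
import HarnessLib

/-!
# Vélu's formulae for a kernel without `2`-torsion, in Kohel's symmetric form — proved by a
# formal-point argument (no Riemann–Roch, no function-field theory)

Trunk T-NT-EC (Literature/NumberTheory/EllipticCurves). Let `E : y² = f(x) = x³ + a₄x + a₆` be a
short Weierstrass (elliptic) curve over a field `F` of characteristic `0`, and let `G ⊆ E(F)` be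
a finite subgroup without points of order `2` (e.g. of odd order) — encoded as a `Finset` of
points with the closure properties `IsOddSubgroupFinset`. Vélu's isogeny `E → E/G` is

  `x'(P) = x(P) + Σ_{v ∈ G∖O} (x(P + v) - x(v))`,  `y'(P) = Σ_{v ∈ G} y(P + v)`,

and Vélu's theorem says that `(x', y')` satisfies `y'² = x'³ + a'x' + b'` for explicit constants
(`a' = a₄ - 5Σt_Q`, `b' = a₆ - 7Σ(u_Q + x_Q t_Q)`). We prove this in KOHEL'S FORM with all sums
taken symmetrically over `G ∖ O` (no choice of representatives modulo `±`):

* `veluP₂ G = Π_{v ≠ O}(X - x(v))` (the square of the kernel polynomial), `veluU = X·P₂ + U₁`,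
  `veluS = P₂² + S₁` (explicit, `veluU₁`, `veluS₁`), and **`veluP₂_mul_sum_xOf`**,
  **`veluP₂_sq_mul_sum_yOf`**: `x' = U/P₂`, `y' = y·S/P₂²` as functions of an affine point
  `P = (x, y)` off the kernel (from the chord formulae `sq_mul_xOf_add_add_xOf_sub`,
  `cube_mul_yOf_add_add_yOf_sub` for `x(P+v) + x(P-v)`, `y(P+v) + y(P-v)`, and pairing `v`
  with `-v`);
* `veluA G = a'`, `veluB G = b'` DEFINED as the coefficients killing the top two terms of
  `N := f·S² - P₂·(U³ + a'U P₂² + b'P₂³)` (`veluN`, `natDegree_veluN_le : deg N ≤ 4m - 1`,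
  `m = #(G ∖ O)`);
* **`veluN_eq_zero` (Vélu's theorem): `N = 0`**, i.e. `veluF_mul_veluS_sq`:
  `f·S² = P₂·(U³ + a'UP₂² + b'P₂³)`, and **`veluMap_mem`**: the point
  `(x', y') = (Σ_{v∈G} x(P+v) - Σ_{v≠O} x(v), Σ_{v∈G} y(P+v))` lies on `y² = x³ + a'x + b'`.

## The proof (a formal neighbourhood replaces the analysis of poles)

`N/P₂⁴ = (yS/P₂²)² - (U/P₂)³ - a'(U/P₂) - b'` is a polynomial in the two Vélu sums, which are
invariant under `P ↦ P + u`, `u ∈ G` (reindex the sum over the group; `eval_veluN_mul_eq`). We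
evaluate at the FORMAL POINT `T = (x(z), y(z)) = (z⁻²X(z), -z⁻³X(z))` of `E` over the Laurent
series field `F((z))` (`equation_formalPoint`; `X = z²x(z) = formalXMulSq` of the tree) and at
`T + u`: by the chord formula `x(T + u) = x(u) + 2y(u)·z + O(z²)` is a power series
(`exists_formalTranslateX`, `exists_formalPoint_add_eq`; this needs `X ≡ 1 (mod z⁴)`,
`X_pow_four_dvd_formalXMulSq_sub_one`), with a SIMPLE zero against `X - x(u)` because
`y(u) ≠ 0` (no `2`-torsion). Clearing the powers of `z` and pulling back along the injection
`F⟦z⟧ → F((z))` gives `z^{8m+8}·A = z^{k+2e}·B` in `F⟦z⟧` with `B(0) ≠ 0`, `e = 4m - 1`,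
`k = mult_{x(u)} N`; hence `k ≥ 10` for every `u ∈ G ∖ O` (`X_sub_C_pow_ten_dvd_veluN`). Since `x`
is at most `2`-to-`1` on `G ∖ O` (`card_filter_xOf_le_two`), `deg N ≥ 5m` unless `N = 0`,
contradicting `deg N ≤ 4m - 1`.

Purpose in the tree: the explicit quotient by a finite subgroup is the algebraic input of the
canonical `p`-isogeny in Blakestad–Grant's construction of the Mazur–Tate sigma function
(J. Number Theory 249 (2023), Prop. 7, Lemma 11 (Vélu), Prop. 13; existence half of the tree's
named fact `WeierstrassCurve.mazur_tate_sigma_existsUnique`), and of the tree's named fact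
`WeierstrassCurve.exists_separable_isogeny_ker_eq` (Silverman AEC III.4.12, the separable
quotient) in the odd-order case.

## Sources

* J. Vélu, *Isogénies entre courbes elliptiques*, C. R. Acad. Sci. Paris Sér. A 273 (1971),
  238–241 (the formulae `X = x + Σ_{Q∈S}(t_Q/(x-x_Q) + u_Q/(x-x_Q)²)`, `A₄' = A₄ - 5t`,
  `A₆' = A₆ - 7w`). [Velu1971]
* D. Kohel, *Endomorphism rings of elliptic curves over finite fields*, PhD thesis, Berkeley
  (1996), §2.4 (the isogeny from the kernel polynomial). [Kohel1996]
* J. H. Silverman, *The Arithmetic of Elliptic Curves*, 2nd ed. (2009), III.2.3 (group law),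
  III.4.12–4.13 (quotient by a finite subgroup; Vélu), IV.1 (`x(z)`, `y(z)`). [SilvermanAEC2009]
* C. Blakestad, D. Grant, J. Number Theory 249 (2023), Lemma 11 and Prop. 7 (use of Vélu for
  the canonical subgroup). [BlakestadGrant2023]

## Design notes

* Points are Mathlib's `WeierstrassCurve.Affine.Point`; the kernel is a `Finset` of points of
  `W⁄F = W.baseChange F` (same points as `W`, but this spelling is what `Point.map` expects).
  Definitions introduced: `xOf`, `yOf`, `IsOddSubgroupFinset`, `veluP₂`, `veluQ`, `veluT`, `veluWc`,
  `veluU₁`, `veluU`, `veluS₁`, `veluS`, `veluF`, `veluM₁`, `veluA`, `veluM`, `veluB`, `veluN` — all with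
  bodies; no named fact.
* Laurent series: `LaurentSeries F` with `HahnSeries.ofPowerSeries ℤ F`; the scalar tower
  `F → F → F((z))` is registered for the `Algebra.toSMul` actions (`instIsScalarTowerLaurent`)
  because of the `HahnSeries` scalar-action diamond. Only ring-homomorphism properties and the
  injectivity of `F⟦z⟧ → F((z))` are used (no valuations).
* Characteristic `0` is assumed where `2 ≠ 0` and torsion-freeness are needed; `a'`, `b'` are the
  Vélu constants by uniqueness (not re-derived in closed form here).
-/

noncomputable section

open scoped Classical

namespace WeierstrassCurve.Affine.Point

open Polynomial

/-! ### Coordinates of affine points; the pair identities `x(P+v) + x(P-v)`, `y(P+v) + y(P-v)` -/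

section Coordinates

variable {K : Type*} [Field K] {W : WeierstrassCurve K}

/-- The `x`-coordinate of an affine point (`0` at `O`). [folklore] -/
def xOf : W.toAffine.Point → K
  | 0 => 0
  | some x _ _ => x

/-- The `y`-coordinate of an affine point (`0` at `O`). [folklore] -/
def yOf : W.toAffine.Point → K
  | 0 => 0
  | some _ y _ => y

/-- `x(O) := 0` (junk value). [folklore] -/
@[simp] theorem xOf_zero : xOf (0 : W.toAffine.Point) = 0 := rfl
/-- `y(O) := 0` (junk value). [folklore] -/
@[simp] theorem yOf_zero : yOf (0 : W.toAffine.Point) = 0 := rfl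
/-- `x((x, y)) = x`. [folklore] -/
@[simp] theorem xOf_some {x y : K} (h : W.toAffine.Nonsingular x y) : xOf (some x y h) = x := rfl
/-- `y((x, y)) = y`. [folklore] -/
@[simp] theorem yOf_some {x y : K} (h : W.toAffine.Nonsingular x y) : yOf (some x y h) = y := rfl

/-- `x(-P) = x(P)`. [folklore] -/
@[simp] theorem xOf_neg (P : W.toAffine.Point) : xOf (-P) = xOf P := by
  rcases P with _ | ⟨x, y, h⟩ <;> rfl

/-- An affine point is determined by its coordinates. [folklore] -/
theorem eq_of_xOf_eq_of_yOf_eq {P Q : W.toAffine.Point} (hP : P ≠ 0) (hQ : Q ≠ 0)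
    (hx : xOf P = xOf Q) (hy : yOf P = yOf Q) : P = Q := by
  rcases P with _ | ⟨x₁, y₁, h₁⟩
  · exact (hP rfl).elim
  rcases Q with _ | ⟨x₂, y₂, h₂⟩
  · exact (hQ rfl).elim
  simp only [xOf_some, yOf_some] at hx hy
  subst hx; subst hy; rfl

/-- Points with the same `x`-coordinate are equal or opposite. [Silverman AEC III.2.3] [folklore] -/
theorem eq_or_eq_neg_of_xOf_eq {P Q : W.toAffine.Point} (hP : P ≠ 0) (hQ : Q ≠ 0)
    (hx : xOf P = xOf Q) : P = Q ∨ P = -Q := by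
  rcases P with _ | ⟨x₁, y₁, h₁⟩
  · exact (hP rfl).elim
  rcases Q with _ | ⟨x₂, y₂, h₂⟩
  · exact (hQ rfl).elim
  simp only [xOf_some] at hx
  exact X_eq_iff.mp hx

variable [W.IsShortNF]

/-- `-(x, y) = (x, -y)` on a short Weierstrass model. [Silverman AEC III.2.3] [folklore] -/
theorem negY_of_isShortNF (x y : K) : W.toAffine.negY x y = -y := by
  rw [Affine.negY, W.a₁_of_isShortNF, W.a₃_of_isShortNF]; ring

/-- `y(-P) = -y(P)` (short model). [folklore] -/
@[simp] theorem yOf_neg (P : W.toAffine.Point) : yOf (-P) = -yOf P := by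
  rcases P with _ | ⟨x, y, h⟩
  · show (0 : K) = -0
    rw [_root_.neg_zero]
  · rw [neg_some, yOf_some, yOf_some, negY_of_isShortNF]

/-- A nonzero point equal to its opposite has `y = 0` (short model). [folklore] -/
theorem yOf_eq_zero_of_neg_eq_self (h2 : (2 : K) ≠ 0) {P : W.toAffine.Point} (h : -P = P) :
    yOf P = 0 := by
  rcases P with _ | ⟨x, y, hP⟩
  · rfl
  · have := congrArg yOf h
    rw [yOf_neg, yOf_some] at this
    have h' : (2 : K) * y = 0 := by linear_combination -this
    exact (mul_eq_zero.mp h').resolve_left h2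

/-- The Weierstrass equation `y² = x³ + a₄x + a₆` of a point on a short model. [folklore] -/
theorem yOf_sq_eq {x y : K} (h : W.toAffine.Nonsingular x y) :
    y ^ 2 = x ^ 3 + W.a₄ * x + W.a₆ := by
  have he := h.1
  rw [Affine.equation_iff, W.a₁_of_isShortNF, W.a₂_of_isShortNF, W.a₃_of_isShortNF] at he
  linear_combination he

/-- **`x(P + v) + x(P - v)`** for `x(P) ≠ x(v)` on `y² = f(x)`:
`(x₁ - x₂)²·(x(P+v) + x(P-v)) = 2(y₁² + y₂²) - 2(x₁ + x₂)(x₁ - x₂)²`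
(`= 2(f(x₁) + f(x₂)) - 2(x₁ + x₂)(x₁ - x₂)²`). [Silverman AEC III.2.3 (group law algorithm);
Blakestad–Grant 2023, Lemma 10 (`τ_u^*x + τ_{-u}^*x`)] [folklore] -/
theorem sq_mul_xOf_add_add_xOf_sub {x₁ y₁ x₂ y₂ : K} (h₁ : W.toAffine.Nonsingular x₁ y₁)
    (h₂ : W.toAffine.Nonsingular x₂ y₂) (hx : x₁ ≠ x₂) :
    (x₁ - x₂) ^ 2 * (xOf (some x₁ y₁ h₁ + some x₂ y₂ h₂) + xOf (some x₁ y₁ h₁ - some x₂ y₂ h₂)) =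
      2 * (y₁ ^ 2 + y₂ ^ 2) - 2 * (x₁ + x₂) * (x₁ - x₂) ^ 2 := by
  have hx' : x₁ - x₂ ≠ 0 := sub_ne_zero.mpr hx
  rw [sub_eq_add_neg (some x₁ y₁ h₁), neg_some, add_of_X_ne hx, add_of_X_ne hx, xOf_some, xOf_some,
    Affine.addX, Affine.addX, Affine.slope_of_X_ne hx, Affine.slope_of_X_ne hx, negY_of_isShortNF,
    W.a₁_of_isShortNF, W.a₂_of_isShortNF]
  field_simp
  ring

/-- **`y(P + v) + y(P - v)`** for `x(P) ≠ x(v)` on `y² = f(x)`: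
`(x₁ - x₂)³·(y(P+v) + y(P-v)) = -2y₁·(y₁² + 3y₂² - (2x₁ + x₂)(x₁ - x₂)² + (x₁ - x₂)³)`.
(With `y₁² = f(x₁)`, `y₂² = f(x₂)` this is `y₁·∂_{x₁}(x(P+v) + x(P-v))`: the invariant
differential `dx/2y` is translation invariant.) [Silverman AEC III.2.3, III.5.1] [folklore] -/
theorem cube_mul_yOf_add_add_yOf_sub {x₁ y₁ x₂ y₂ : K} (h₁ : W.toAffine.Nonsingular x₁ y₁)
    (h₂ : W.toAffine.Nonsingular x₂ y₂) (hx : x₁ ≠ x₂) :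
    (x₁ - x₂) ^ 3 * (yOf (some x₁ y₁ h₁ + some x₂ y₂ h₂) + yOf (some x₁ y₁ h₁ - some x₂ y₂ h₂)) =
      -2 * y₁ * (y₁ ^ 2 + 3 * y₂ ^ 2 - (2 * x₁ + x₂) * (x₁ - x₂) ^ 2 + (x₁ - x₂) ^ 3) := by
  have hx' : x₁ - x₂ ≠ 0 := sub_ne_zero.mpr hx
  rw [sub_eq_add_neg (some x₁ y₁ h₁), neg_some, add_of_X_ne hx, add_of_X_ne hx, yOf_some, yOf_some,
    Affine.addY, Affine.addY, Affine.negAddY, Affine.negAddY, Affine.addX, Affine.addX,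
    Affine.slope_of_X_ne hx, Affine.slope_of_X_ne hx, negY_of_isShortNF, negY_of_isShortNF,
    negY_of_isShortNF, W.a₁_of_isShortNF, W.a₂_of_isShortNF]
  field_simp
  ring

end Coordinates

/-! ### Finite subgroups without `2`-torsion: pairing and translation of sums -/

section Subgroup

variable {K : Type*} [Field K] {W : WeierstrassCurve K}

/-- The standing hypotheses on the kernel `G`: a finite set of `K`-points containing `O`, closed
under the group law and under negation, and without points of order `2` (e.g. a subgroup of odd
order). [Vélu 1971; Kohel 1996, §2.4] [folklore] -/
structure IsOddSubgroupFinset (G : Finset W.toAffine.Point) : Prop where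
  zero_mem : (0 : W.toAffine.Point) ∈ G
  add_mem : ∀ u ∈ G, ∀ v ∈ G, u + v ∈ G
  neg_mem : ∀ v ∈ G, -v ∈ G
  eq_zero_of_neg_eq : ∀ v ∈ G, -v = v → v = 0

namespace IsOddSubgroupFinset

variable {G : Finset W.toAffine.Point} (hG : IsOddSubgroupFinset G)
include hG

/-- `G ∖ O` is closed under negation. [folklore] -/
theorem neg_mem_erase {v : W.toAffine.Point} (hv : v ∈ G.erase 0) : -v ∈ G.erase 0 := by
  obtain ⟨hv0, hvG⟩ := Finset.mem_erase.mp hv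
  refine Finset.mem_erase.mpr ⟨fun h => hv0 ?_, hG.neg_mem v hvG⟩
  rw [← neg_neg v, h]; rfl

/-- No point of `G ∖ O` is its own opposite. [folklore] -/
theorem neg_ne_self {v : W.toAffine.Point} (hv : v ∈ G.erase 0) : -v ≠ v := fun h =>
  (Finset.mem_erase.mp hv).1 (hG.eq_zero_of_neg_eq v (Finset.mem_erase.mp hv).2 h)

/-- `2 ≤ #(G ∖ O)` as soon as `G ≠ O` (the points `v ≠ -v` come in pairs). [folklore] -/
theorem card_erase_erase {v : W.toAffine.Point} (hv : v ∈ G.erase 0) :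
    (((G.erase 0).erase v).erase (-v)).card = (G.erase 0).card - 2 := by
  have h1 : -v ∈ (G.erase 0).erase v := Finset.mem_erase.mpr ⟨hG.neg_ne_self hv, hG.neg_mem_erase hv⟩
  rw [Finset.card_erase_of_mem h1, Finset.card_erase_of_mem hv]
  omega

/-- `2 ≤ #(G ∖ O)` as soon as `G ≠ O`. [folklore] -/
theorem two_le_card {v : W.toAffine.Point} (hv : v ∈ G.erase 0) : 2 ≤ (G.erase 0).card := by
  have h1 : -v ∈ (G.erase 0).erase v := Finset.mem_erase.mpr ⟨hG.neg_ne_self hv, hG.neg_mem_erase hv⟩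
  have := Finset.card_pos.mpr ⟨_, h1⟩
  rw [Finset.card_erase_of_mem hv] at this
  omega

/-- **Pairing**: `Σ_{v ≠ O} φ(v) = ½ Σ_{v ≠ O} (φ(v) + φ(-v))`. [folklore] -/
theorem sum_erase_zero_eq_half_sum (h2 : (2 : K) ≠ 0) (φ : W.toAffine.Point → K) :
    ∑ v ∈ G.erase 0, φ v = 2⁻¹ * ∑ v ∈ G.erase 0, (φ v + φ (-v)) := by
  have hre : ∑ v ∈ G.erase 0, φ (-v) = ∑ v ∈ G.erase 0, φ v :=
    Finset.sum_nbij' (fun v => -v) (fun v => -v) (fun v hv => hG.neg_mem_erase hv)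
      (fun v hv => hG.neg_mem_erase hv) (fun v _ => neg_neg v) (fun v _ => neg_neg v) (fun v _ => rfl)
  rw [Finset.sum_add_distrib, hre, ← two_mul, ← mul_assoc, inv_mul_cancel₀ h2, one_mul]

/-- **Translation invariance of sums over `G`**: `Σ_{v ∈ G} ψ(u + v) = Σ_{v ∈ G} ψ(v)` for `u ∈ G`.
[folklore] -/
theorem sum_comp_add_left {M : Type*} [AddCommMonoid M] (ψ : W.toAffine.Point → M)
    {u : W.toAffine.Point} (hu : u ∈ G) : ∑ v ∈ G, ψ (u + v) = ∑ v ∈ G, ψ v :=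
  Finset.sum_nbij' (fun v => u + v) (fun v => -u + v) (fun v hv => hG.add_mem u hu v hv)
    (fun v hv => hG.add_mem _ (hG.neg_mem u hu) v hv) (fun v _ => by abel) (fun v _ => by abel)
    (fun v _ => rfl)

end IsOddSubgroupFinset

/-! ### Kohel's polynomials of the kernel (short model `y² = f(x) = x³ + a₄x + a₆`) -/

section Polynomials

variable (G : Finset W.toAffine.Point)

/-- `P₂ = Π_{v ∈ G ∖ O} (X - x(v))` — the SQUARE of the kernel polynomial `Π_{±v}(X - x(v))`
(each `x`-value occurs for `v` and `-v`). [Kohel 1996, §2.4; Vélu 1971] [folklore] -/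
def veluP₂ : K[X] := ∏ v ∈ G.erase 0, (Polynomial.X - C (xOf v))

/-- `Q_v = Π_{v' ∈ G ∖ {O, v, -v}} (X - x(v'))`, so that `(X - x(v))²·Q_v = P₂`. [folklore] -/
def veluQ (v : W.toAffine.Point) : K[X] :=
  ∏ v' ∈ ((G.erase 0).erase v).erase (-v), (Polynomial.X - C (xOf v'))

/-- Vélu's `t_v = 6x(v)² + 2a₄` (`= 2·(3x_Q² + a₄)`). [Vélu 1971 (`t_Q`)] [folklore] -/
def veluT (v : W.toAffine.Point) : K := 6 * xOf v ^ 2 + 2 * W.a₄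

/-- `w_v = -2x(v)³ + 2a₄x(v) + 4a₆` (`= u_Q - x_Q t_Q` with Vélu's `u_Q = 4y_Q²`). [Vélu 1971]
[folklore] -/
def veluWc (v : W.toAffine.Point) : K := -2 * xOf v ^ 3 + 2 * W.a₄ * xOf v + 4 * W.a₆

/-- `U₁ = ½ Σ_{v ≠ O} (t_v X + w_v)·Q_v`, the polar part of `P₂·x'`. [folklore] -/
def veluU₁ : K[X] := C (2⁻¹ : K) * ∑ v ∈ G.erase 0, (C (veluT v) * Polynomial.X + C (veluWc v)) * veluQ G v

/-- **`U = X·P₂ + U₁`**, the numerator of the `x`-coordinate `x' = U/P₂` of Vélu's isogeny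
(`x'(P) = x(P) + Σ_{v ≠ O} (x(P + v) - x(v))`). [Vélu 1971; Kohel 1996, §2.4] [folklore] -/
def veluU : K[X] := Polynomial.X * veluP₂ G + veluU₁ G

/-- `S₁ = ½ Σ_{v ≠ O} Q_v²·(X - x(v))·(-t_v X - t_v x(v) - 2w_v)`, the polar part of `P₂²·(x')'`.
[folklore] -/
def veluS₁ : K[X] := C (2⁻¹ : K) * ∑ v ∈ G.erase 0,
  veluQ G v ^ 2 * (Polynomial.X - C (xOf v)) * (C (-veluT v) * Polynomial.X + C (-veluT v * xOf v - 2 * veluWc v))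

/-- **`S = P₂² + S₁`**, the numerator of `(x')' = S/P₂²`; the `y`-coordinate of Vélu's isogeny is
`y' = y·S/P₂²` (`y'(P) = Σ_{v ∈ G} y(P + v)`). [Vélu 1971; Kohel 1996, §2.4] [folklore] -/
def veluS : K[X] := veluP₂ G ^ 2 + veluS₁ G

variable {G}

/-- `(X - x(v))²·Q_v = P₂` for `v ∈ G ∖ O`. [folklore] -/
theorem sq_mul_veluQ (hG : IsOddSubgroupFinset G) {v : W.toAffine.Point} (hv : v ∈ G.erase 0) :
    (Polynomial.X - C (xOf v)) ^ 2 * veluQ G v = veluP₂ G := by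
  have h1 : -v ∈ (G.erase 0).erase v := Finset.mem_erase.mpr ⟨hG.neg_ne_self hv, hG.neg_mem_erase hv⟩
  rw [veluP₂, ← Finset.mul_prod_erase _ _ hv, ← Finset.mul_prod_erase _ _ h1, xOf_neg, veluQ]
  ring

/-- `P₂` is monic. [folklore] -/
theorem monic_veluP₂ : (veluP₂ G).Monic :=
  monic_prod_of_monic _ _ fun _ _ => monic_X_sub_C _

/-- `deg P₂ = #(G ∖ O)`. [folklore] -/
theorem natDegree_veluP₂ : (veluP₂ G).natDegree = (G.erase 0).card := by
  rw [veluP₂, natDegree_prod_of_monic _ _ fun _ _ => monic_X_sub_C _]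
  simp

/-- `Q_v` is monic. [folklore] -/
theorem monic_veluQ (v : W.toAffine.Point) : (veluQ G v).Monic :=
  monic_prod_of_monic _ _ fun _ _ => monic_X_sub_C _

/-- `deg Q_v = #(G ∖ O) - 2`. [folklore] -/
theorem natDegree_veluQ (hG : IsOddSubgroupFinset G) {v : W.toAffine.Point} (hv : v ∈ G.erase 0) :
    (veluQ G v).natDegree = (G.erase 0).card - 2 := by
  rw [veluQ, natDegree_prod_of_monic _ _ fun _ _ => monic_X_sub_C _]
  simp [hG.card_erase_erase hv]

/-- `deg U₁ ≤ #(G ∖ O) - 1`. [folklore] -/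
theorem natDegree_veluU₁_le (hG : IsOddSubgroupFinset G) :
    (veluU₁ G).natDegree ≤ (G.erase 0).card - 1 := by
  refine (natDegree_C_mul_le _ _).trans (natDegree_sum_le_of_forall_le _ _ fun v hv => ?_)
  refine (natDegree_mul_le).trans ?_
  have h1 : (C (veluT v) * Polynomial.X + C (veluWc v)).natDegree ≤ 1 := by
    refine (natDegree_add_le _ _).trans (max_le ((natDegree_C_mul_le _ _).trans natDegree_X_le) ?_)
    rw [natDegree_C]; exact Nat.zero_le _
  have h2 := hG.two_le_card hv
  rw [natDegree_veluQ hG hv]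
  omega

/-- `deg S₁ ≤ 2·#(G ∖ O) - 2`. [folklore] -/
theorem natDegree_veluS₁_le (hG : IsOddSubgroupFinset G) :
    (veluS₁ G).natDegree ≤ 2 * (G.erase 0).card - 2 := by
  refine (natDegree_C_mul_le _ _).trans (natDegree_sum_le_of_forall_le _ _ fun v hv => ?_)
  refine (natDegree_mul_le).trans ?_
  have h1 : (C (-veluT v) * Polynomial.X + C (-veluT v * xOf v - 2 * veluWc v)).natDegree ≤ 1 := by
    refine (natDegree_add_le _ _).trans (max_le ((natDegree_C_mul_le _ _).trans natDegree_X_le) ?_)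
    rw [natDegree_C]; exact Nat.zero_le _
  have h2 := hG.two_le_card hv
  have h3 : (veluQ G v ^ 2 * (Polynomial.X - C (xOf v))).natDegree ≤ 2 * ((G.erase 0).card - 2) + 1 := by
    refine (natDegree_mul_le).trans (add_le_add ((natDegree_pow_le).trans ?_) (natDegree_X_sub_C_le _))
    rw [natDegree_veluQ hG hv]
  omega

/-- `U` is monic of degree `#(G ∖ O) + 1`. [folklore] -/
theorem monic_veluU (hG : IsOddSubgroupFinset G) : (veluU G).Monic := by
  have hXP : (Polynomial.X * veluP₂ G).Monic := monic_X.mul monic_veluP₂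
  have hdeg : (Polynomial.X * veluP₂ G).natDegree = (G.erase 0).card + 1 := by
    rw [monic_X.natDegree_mul monic_veluP₂, natDegree_X, natDegree_veluP₂, add_comm]
  rw [veluU]
  refine hXP.add_of_left ?_
  rw [degree_eq_natDegree hXP.ne_zero, hdeg]
  refine (degree_le_natDegree.trans_lt ?_)
  exact_mod_cast Nat.lt_succ_of_le ((natDegree_veluU₁_le hG).trans (Nat.sub_le _ _))

/-- `deg U = #(G ∖ O) + 1`. [folklore] -/
theorem natDegree_veluU (hG : IsOddSubgroupFinset G) : (veluU G).natDegree = (G.erase 0).card + 1 := by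
  have hdeg : (Polynomial.X * veluP₂ G).natDegree = (G.erase 0).card + 1 := by
    rw [monic_X.natDegree_mul monic_veluP₂, natDegree_X, natDegree_veluP₂, add_comm]
  rw [veluU, natDegree_add_eq_left_of_natDegree_lt, hdeg]
  rw [hdeg]
  exact Nat.lt_succ_of_le ((natDegree_veluU₁_le hG).trans (Nat.sub_le _ _))

end Polynomials

/-! ### The Vélu sums `Σ_{v ∈ G} x(P + v)`, `Σ_{v ∈ G} y(P + v)` as rational functions of `P` -/

section Sums

variable {G : Finset W.toAffine.Point} [W.IsShortNF]

/-- **`P₂(x)·(Σ_{v ∈ G} x(P+v) - Σ_{v ≠ O} x(v)) = U(x)`** for an affine point `P = (x, y)` with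
`x ≠ x(v)` for all `v ∈ G ∖ O`: Vélu's `x`-coordinate is the rational function `U/P₂` of `x`.
[Vélu 1971 (`X = x + Σ_{Q ∈ S}(t_Q/(x - x_Q) + u_Q/(x - x_Q)²)`); Kohel 1996, §2.4]
[cite: Velu1971] -/
theorem veluP₂_mul_sum_xOf (hG : IsOddSubgroupFinset G) (h2 : (2 : K) ≠ 0) {x₀ y₀ : K}
    (h₀ : W.toAffine.Nonsingular x₀ y₀) (hgood : ∀ v ∈ G.erase 0, xOf v ≠ x₀) :
    (veluP₂ G).eval x₀ * (∑ v ∈ G, xOf (some x₀ y₀ h₀ + v) - ∑ v ∈ G.erase 0, xOf v) =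
      (veluU G).eval x₀ := by
  set P : W.toAffine.Point := some x₀ y₀ h₀ with hP
  -- split off `v = O` and pair `v` with `-v`
  have hsplit : ∑ v ∈ G, xOf (P + v) = x₀ + ∑ v ∈ G.erase 0, xOf (P + v) := by
    rw [← Finset.add_sum_erase _ _ hG.zero_mem, add_zero, hP, xOf_some]
  have hpair := hG.sum_erase_zero_eq_half_sum h2 (fun v => xOf (P + v))
  -- each pair is an explicit rational function of `x₀`
  have hterm : ∀ v ∈ G.erase 0, (xOf (P + v) + xOf (P + -v)) - 2 * xOf v =
      (veluT v * x₀ + veluWc v) / (x₀ - xOf v) ^ 2 := by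
    intro v hv
    have hv0 : v ≠ 0 := (Finset.mem_erase.mp hv).1
    rcases v with _ | ⟨x₂, y₂, h₂⟩
    · exact (hv0 rfl).elim
    have hx : x₀ ≠ x₂ := fun h => hgood _ hv (by rw [xOf_some, h])
    have hx' : x₀ - x₂ ≠ 0 := sub_ne_zero.mpr hx
    have hpairv := sq_mul_xOf_add_add_xOf_sub h₀ h₂ hx
    rw [sub_eq_add_neg (some x₀ y₀ h₀)] at hpairv
    rw [xOf_some, veluT, veluWc, xOf_some, eq_div_iff (pow_ne_zero 2 hx'), hP]
    have e₀ := yOf_sq_eq h₀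
    have e₂ := yOf_sq_eq h₂
    linear_combination hpairv + 2 * e₀ + 2 * e₂
  -- the right-hand side, with `Q_v(x₀) = P₂(x₀)/(x₀ - x(v))²`
  have hQ : ∀ v ∈ G.erase 0, (veluQ G v).eval x₀ = (veluP₂ G).eval x₀ / (x₀ - xOf v) ^ 2 := by
    intro v hv
    have hx' : x₀ - xOf v ≠ 0 := sub_ne_zero.mpr (fun h => hgood v hv h.symm)
    rw [eq_div_iff (pow_ne_zero 2 hx'), ← sq_mul_veluQ hG hv, eval_mul, eval_pow, eval_sub, eval_X,
      eval_C, mul_comm]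
  rw [hsplit, hpair, veluU, veluU₁, eval_add, eval_mul, eval_X, eval_mul, eval_C, eval_finsetSum]
  have hsum : ∑ v ∈ G.erase 0, ((C (veluT v) * Polynomial.X + C (veluWc v)) * veluQ G v).eval x₀ =
      (veluP₂ G).eval x₀ * ∑ v ∈ G.erase 0, ((xOf (P + v) + xOf (P + -v)) - 2 * xOf v) := by
    rw [Finset.mul_sum]
    refine Finset.sum_congr rfl fun v hv => ?_
    have hx' : x₀ - xOf v ≠ 0 := sub_ne_zero.mpr (fun h => hgood v hv h.symm)
    rw [eval_mul, eval_add, eval_mul, eval_C, eval_X, eval_C, hQ v hv, hterm v hv]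
    field_simp
  have h2sum : ∑ v ∈ G.erase 0, 2 * xOf v = 2 * ∑ v ∈ G.erase 0, xOf v := by rw [Finset.mul_sum]
  rw [hsum, Finset.sum_sub_distrib, h2sum]
  field_simp
  ring

/-- **`P₂(x)²·Σ_{v ∈ G} y(P+v) = y·S(x)`** for an affine point `P = (x, y)` with `x ≠ x(v)` for all
`v ∈ G ∖ O`: Vélu's `y`-coordinate is `y·S/P₂²`. [Vélu 1971 (`Y = y - Σ_{Q∈S}(u_Q 2y/(x-x_Q)³ +
t_Q (y - y_Q)/(x-x_Q)² …)`); Kohel 1996, §2.4] [cite: Velu1971] -/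
theorem veluP₂_sq_mul_sum_yOf (hG : IsOddSubgroupFinset G) (h2 : (2 : K) ≠ 0) {x₀ y₀ : K}
    (h₀ : W.toAffine.Nonsingular x₀ y₀) (hgood : ∀ v ∈ G.erase 0, xOf v ≠ x₀) :
    (veluP₂ G).eval x₀ ^ 2 * ∑ v ∈ G, yOf (some x₀ y₀ h₀ + v) = y₀ * (veluS G).eval x₀ := by
  set P : W.toAffine.Point := some x₀ y₀ h₀ with hP
  have hsplit : ∑ v ∈ G, yOf (P + v) = y₀ + ∑ v ∈ G.erase 0, yOf (P + v) := by
    rw [← Finset.add_sum_erase _ _ hG.zero_mem, add_zero, hP, yOf_some]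
  have hpair := hG.sum_erase_zero_eq_half_sum h2 (fun v => yOf (P + v))
  have hterm : ∀ v ∈ G.erase 0, yOf (P + v) + yOf (P + -v) =
      y₀ * (-veluT v * x₀ + (-veluT v * xOf v - 2 * veluWc v)) / (x₀ - xOf v) ^ 3 := by
    intro v hv
    have hv0 : v ≠ 0 := (Finset.mem_erase.mp hv).1
    rcases v with _ | ⟨x₂, y₂, h₂⟩
    · exact (hv0 rfl).elim
    have hx : x₀ ≠ x₂ := fun h => hgood _ hv (by rw [xOf_some, h])
    have hx' : x₀ - x₂ ≠ 0 := sub_ne_zero.mpr hx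
    have hpairv := cube_mul_yOf_add_add_yOf_sub h₀ h₂ hx
    rw [sub_eq_add_neg (some x₀ y₀ h₀)] at hpairv
    rw [xOf_some, veluT, veluWc, xOf_some, eq_div_iff (pow_ne_zero 3 hx'), hP]
    have e₀ := yOf_sq_eq h₀
    have e₂ := yOf_sq_eq h₂
    linear_combination hpairv - 2 * y₀ * e₀ - 6 * y₀ * e₂
  have hQ : ∀ v ∈ G.erase 0, (veluQ G v).eval x₀ = (veluP₂ G).eval x₀ / (x₀ - xOf v) ^ 2 := by
    intro v hv
    have hx' : x₀ - xOf v ≠ 0 := sub_ne_zero.mpr (fun h => hgood v hv h.symm)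
    rw [eq_div_iff (pow_ne_zero 2 hx'), ← sq_mul_veluQ hG hv, eval_mul, eval_pow, eval_sub, eval_X,
      eval_C, mul_comm]
  rw [hsplit, hpair, veluS, veluS₁, eval_add, eval_pow, eval_mul, eval_C, eval_finsetSum]
  set g : W.toAffine.Point → K := fun v =>
    (-veluT v * x₀ + (-veluT v * xOf v - 2 * veluWc v)) / (x₀ - xOf v) ^ 3 with hg
  have hsum : ∑ v ∈ G.erase 0, (veluQ G v ^ 2 * (Polynomial.X - C (xOf v)) *
      (C (-veluT v) * Polynomial.X + C (-veluT v * xOf v - 2 * veluWc v))).eval x₀ =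
      (veluP₂ G).eval x₀ ^ 2 * ∑ v ∈ G.erase 0, g v := by
    rw [Finset.mul_sum]
    refine Finset.sum_congr rfl fun v hv => ?_
    have hx' : x₀ - xOf v ≠ 0 := sub_ne_zero.mpr (fun h => hgood v hv h.symm)
    rw [eval_mul, eval_mul, eval_pow, eval_sub, eval_X, eval_C, eval_add, eval_mul, eval_C, eval_X,
      eval_C, hQ v hv, hg]
    field_simp
  have hpairsum : ∑ v ∈ G.erase 0, (yOf (P + v) + yOf (P + -v)) = y₀ * ∑ v ∈ G.erase 0, g v := by
    rw [Finset.mul_sum]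
    refine Finset.sum_congr rfl fun v hv => ?_
    rw [hterm v hv, hg, mul_div_assoc]
  rw [hsum, hpairsum]
  ring

end Sums

/-! ### The target curve `y² = x³ + a'x + b'`: `a'`, `b'` kill the top coefficients of
### `N = f·S² - P₂·(U³ + a'U P₂² + b'P₂³)` -/

section Correction

variable (W) in
/-- `f = X³ + a₄X + a₆` (the short model `y² = f(x)`). [folklore] -/
def veluF : K[X] := Polynomial.X ^ 3 + C W.a₄ * Polynomial.X + C W.a₆

variable (G : Finset W.toAffine.Point)

/-- `M₁ = f·S² - P₂·U³`. [folklore] -/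
def veluM₁ : K[X] := veluF W * veluS G ^ 2 - veluP₂ G * veluU G ^ 3

/-- **Vélu's `a' = a₄ - 5·Σ t_Q`**, here DEFINED as the coefficient of `X^{4m+1}` in `f S² - P₂U³`
(`m = #(G ∖ O)`), i.e. as the unique constant for which `f S² - P₂(U³ + a'UP₂²)` drops in degree.
[Vélu 1971 (`A₄' = A₄ - 5t`)] [folklore] -/
def veluA : K := (veluM₁ G).coeff (4 * (G.erase 0).card + 1)

/-- `M = M₁ - a'·U·P₂³`. [folklore] -/
def veluM : K[X] := veluM₁ G - C (veluA G) * (veluU G * veluP₂ G ^ 3)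

/-- **Vélu's `b' = a₆ - 7·Σ(u_Q + x_Q t_Q)`**, here DEFINED as the coefficient of `X^{4m}` in
`f S² - P₂(U³ + a'UP₂²)`. [Vélu 1971 (`A₆' = A₆ - 7w`)] [folklore] -/
def veluB : K := (veluM G).coeff (4 * (G.erase 0).card)

/-- **`N = f·S² - P₂·(U³ + a'·U·P₂² + b'·P₂³)`** — the numerator of
`y'² - (x'³ + a'x' + b')` (times `P₂⁴`) along `(x', y') = (U/P₂, yS/P₂²)`; Vélu's theorem is
`N = 0`. [Vélu 1971; Kohel 1996, §2.4] [folklore] -/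
def veluN : K[X] := veluM G - C (veluB G) * veluP₂ G ^ 4

/-- `N = f·S² - P₂·(U³ + a'UP₂² + b'P₂³)`. [folklore] -/
theorem veluN_eq : veluN G = veluF W * veluS G ^ 2 -
    veluP₂ G * (veluU G ^ 3 + C (veluA G) * veluU G * veluP₂ G ^ 2 + C (veluB G) * veluP₂ G ^ 3) := by
  rw [veluN, veluM, veluM₁]; ring

variable {G}

/-- `deg (f - X³) ≤ 1`. [folklore] -/
theorem natDegree_veluF_sub_le : (veluF W - Polynomial.X ^ 3).natDegree ≤ 1 := by
  rw [veluF, show Polynomial.X ^ 3 + C W.a₄ * Polynomial.X + C W.a₆ - Polynomial.X ^ 3 =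
    C W.a₄ * Polynomial.X + C W.a₆ by ring]
  refine (natDegree_add_le _ _).trans (max_le ((natDegree_C_mul_le _ _).trans natDegree_X_le) ?_)
  rw [natDegree_C]; exact Nat.zero_le _

/-- `deg f ≤ 3`. [folklore] -/
theorem natDegree_veluF_le : (veluF W).natDegree ≤ 3 := by
  have h : veluF W = (veluF W - Polynomial.X ^ 3) + Polynomial.X ^ 3 := by ring
  rw [h]
  refine (natDegree_add_le _ _).trans (max_le (natDegree_veluF_sub_le.trans (by norm_num)) ?_)
  rw [natDegree_X_pow]

/-- If `deg p, deg q ≤ n + 1` and the `X^{n+1}`-coefficients agree then `deg (p - q) ≤ n`. [folklore] -/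
theorem _root_.Polynomial.natDegree_sub_le_of_coeff_eq {R : Type*} [Ring R] {p q : R[X]} {n : ℕ}
    (hp : p.natDegree ≤ n + 1) (hq : q.natDegree ≤ n + 1) (h : p.coeff (n + 1) = q.coeff (n + 1)) :
    (p - q).natDegree ≤ n := by
  refine natDegree_le_iff_coeff_eq_zero.mpr fun k hk => ?_
  rw [coeff_sub]
  rcases eq_or_lt_of_le (Nat.succ_le_of_lt hk) with hk1 | hk1
  · rw [← hk1, h, sub_self]
  · rw [coeff_eq_zero_of_natDegree_lt (lt_of_le_of_lt hp hk1),
      coeff_eq_zero_of_natDegree_lt (lt_of_le_of_lt hq hk1), sub_self]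

/-- `deg M₁ ≤ 4m + 1` (`m = #(G ∖ O) ≥ 1`). [folklore] -/
theorem natDegree_veluM₁_le (hG : IsOddSubgroupFinset G) (hm : 1 ≤ (G.erase 0).card) :
    (veluM₁ G).natDegree ≤ 4 * (G.erase 0).card + 1 := by
  set m := (G.erase 0).card with hmdef
  have hP : (veluP₂ G).natDegree = m := natDegree_veluP₂
  have hU : (veluU G).natDegree = m + 1 := natDegree_veluU hG
  have hU₁ : (veluU₁ G).natDegree ≤ m - 1 := natDegree_veluU₁_le hG
  have hS₁ : (veluS₁ G).natDegree ≤ 2 * m - 2 := natDegree_veluS₁_le hG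
  have hdecomp : veluM₁ G = (veluF W - Polynomial.X ^ 3) * veluP₂ G ^ 4 +
      veluF W * (veluS₁ G * (veluS₁ G + 2 * veluP₂ G ^ 2)) -
      veluP₂ G * (veluU₁ G * (veluU G ^ 2 + veluU G * (Polynomial.X * veluP₂ G) +
        (Polynomial.X * veluP₂ G) ^ 2)) := by
    rw [veluM₁, veluS, veluU]; ring
  have hXP : (Polynomial.X * veluP₂ G).natDegree = m + 1 := by
    rw [monic_X.natDegree_mul monic_veluP₂, natDegree_X, hP, add_comm]
  have h1 : ((veluF W - Polynomial.X ^ 3) * veluP₂ G ^ 4).natDegree ≤ 4 * m + 1 := by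
    refine natDegree_mul_le.trans ?_
    have := natDegree_pow_le (p := veluP₂ G) (n := 4)
    rw [hP] at this
    have h0 := natDegree_veluF_sub_le (W := W)
    omega
  have h2 : (veluF W * (veluS₁ G * (veluS₁ G + 2 * veluP₂ G ^ 2))).natDegree ≤ 4 * m + 1 := by
    refine natDegree_mul_le.trans ?_
    have h21 : (veluS₁ G * (veluS₁ G + 2 * veluP₂ G ^ 2)).natDegree ≤ (2 * m - 2) + 2 * m := by
      refine natDegree_mul_le.trans (add_le_add hS₁ ((natDegree_add_le _ _).trans (max_le ?_ ?_)))
      · omega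
      · refine natDegree_mul_le.trans ?_
        have := natDegree_pow_le (p := veluP₂ G) (n := 2)
        rw [hP] at this
        have h2c : (2 : K[X]).natDegree = 0 := by
          rw [show (2 : K[X]) = C 2 by rw [map_ofNat], natDegree_C]
        omega
    have h0 := natDegree_veluF_le (W := W)
    omega
  have h3 : (veluP₂ G * (veluU₁ G * (veluU G ^ 2 + veluU G * (Polynomial.X * veluP₂ G) +
      (Polynomial.X * veluP₂ G) ^ 2))).natDegree ≤ 4 * m + 1 := by
    refine natDegree_mul_le.trans ?_
    rw [hP]
    have h31 : (veluU G ^ 2 + veluU G * (Polynomial.X * veluP₂ G) + (Polynomial.X * veluP₂ G) ^ 2).natDegree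
        ≤ 2 * m + 2 := by
      refine (natDegree_add_le _ _).trans (max_le ((natDegree_add_le _ _).trans (max_le ?_ ?_)) ?_)
      · refine natDegree_pow_le.trans ?_; rw [hU]; omega
      · refine natDegree_mul_le.trans ?_; rw [hU, hXP]; omega
      · refine natDegree_pow_le.trans ?_; rw [hXP]; omega
    have h32 := natDegree_mul_le (p := veluU₁ G)
      (q := veluU G ^ 2 + veluU G * (Polynomial.X * veluP₂ G) + (Polynomial.X * veluP₂ G) ^ 2)
    omega
  rw [hdecomp]
  exact (natDegree_sub_le _ _).trans (max_le ((natDegree_add_le _ _).trans (max_le h1 h2)) h3)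

/-- `deg M ≤ 4m`: `a'` kills the top coefficient. [folklore] -/
theorem natDegree_veluM_le (hG : IsOddSubgroupFinset G) (hm : 1 ≤ (G.erase 0).card) :
    (veluM G).natDegree ≤ 4 * (G.erase 0).card := by
  set m := (G.erase 0).card with hmdef
  have hmon : (veluU G * veluP₂ G ^ 3).Monic := (monic_veluU hG).mul (monic_veluP₂.pow 3)
  have hdeg : (veluU G * veluP₂ G ^ 3).natDegree = 4 * m + 1 := by
    rw [(monic_veluU hG).natDegree_mul (monic_veluP₂.pow 3), natDegree_veluU hG,
      monic_veluP₂.natDegree_pow, natDegree_veluP₂]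
    ring
  refine natDegree_sub_le_of_coeff_eq (natDegree_veluM₁_le hG hm) ?_ ?_
  · refine (natDegree_C_mul_le _ _).trans ?_; rw [hdeg]
  · rw [coeff_C_mul, ← hdeg, hmon.coeff_natDegree, mul_one, hdeg]; rfl

/-- **`deg N ≤ 4m - 1`**: `b'` kills the next coefficient, so `y'² - (x'³ + a'x' + b') = N/P₂⁴ = O(1/x)`
at `O`. [Vélu 1971 (choice of `A₄'`, `A₆'`)] [folklore] -/
theorem natDegree_veluN_le (hG : IsOddSubgroupFinset G) (hm : 1 ≤ (G.erase 0).card) :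
    (veluN G).natDegree ≤ 4 * (G.erase 0).card - 1 := by
  set m := (G.erase 0).card with hmdef
  have hmon : (veluP₂ G ^ 4).Monic := monic_veluP₂.pow 4
  have hdeg : (veluP₂ G ^ 4).natDegree = 4 * m := by
    rw [monic_veluP₂.natDegree_pow, natDegree_veluP₂, mul_comm]
  have h4 : 4 * m = (4 * m - 1) + 1 := by omega
  refine natDegree_sub_le_of_coeff_eq (n := 4 * m - 1) ?_ ?_ ?_
  · rw [← h4]; exact natDegree_veluM_le hG hm
  · rw [← h4]; refine (natDegree_C_mul_le _ _).trans ?_; rw [hdeg]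
  · rw [← h4, coeff_C_mul, ← hdeg, hmon.coeff_natDegree, mul_one, hdeg]; rfl

end Correction

/-! ### `G`-invariance: `N(x)/P₂(x)⁴` takes the same value at `P` and at `P + u`, `u ∈ G` -/

section Invariance

variable {G : Finset W.toAffine.Point} [W.IsShortNF]

omit [W.IsShortNF] in
/-- `P₂(x₀) ≠ 0` off the `x`-coordinates of `G ∖ O`. [folklore] -/
theorem eval_veluP₂_ne_zero {x₀ : K} (hgood : ∀ v ∈ G.erase 0, xOf v ≠ x₀) : (veluP₂ G).eval x₀ ≠ 0 := by
  rw [veluP₂, eval_prod]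
  exact Finset.prod_ne_zero_iff.mpr fun v hv => by
    rw [eval_sub, eval_X, eval_C]; exact sub_ne_zero.mpr (hgood v hv).symm

omit [W.IsShortNF] in
/-- `f(x₀) = x₀³ + a₄x₀ + a₆`. [folklore] -/
theorem eval_veluF (x₀ : K) : (veluF W).eval x₀ = x₀ ^ 3 + W.a₄ * x₀ + W.a₆ := by
  simp [veluF]

omit [W.IsShortNF] in
/-- `N(x₀) = f(x₀)S(x₀)² - P₂(x₀)(U(x₀)³ + a'U(x₀)P₂(x₀)² + b'P₂(x₀)³)`. [folklore] -/
theorem eval_veluN (x₀ : K) : (veluN G).eval x₀ = (veluF W).eval x₀ * (veluS G).eval x₀ ^ 2 -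
    (veluP₂ G).eval x₀ * ((veluU G).eval x₀ ^ 3 + veluA G * (veluU G).eval x₀ * (veluP₂ G).eval x₀ ^ 2 +
      veluB G * (veluP₂ G).eval x₀ ^ 3) := by
  rw [veluN_eq]
  simp only [eval_sub, eval_mul, eval_pow, eval_add, eval_C]

/-- **`G`-invariance of `N/P₂⁴`.** If `P = (x₁, y₁)` and `P + u = (x₂, y₂)` (`u ∈ G`) both avoid
the `x`-coordinates of `G ∖ O`, then `N(x₁)·P₂(x₂)⁴ = N(x₂)·P₂(x₁)⁴`: indeed
`N/P₂⁴ = (yS/P₂²)² - (U/P₂)³ - a'(U/P₂) - b'` is a polynomial in the two Vélu sums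
`Σ_{v∈G} x(P+v)`, `Σ_{v∈G} y(P+v)`, which are invariant under `P ↦ P + u` (reindex the sum over
the group `G`). [Vélu 1971 ("les fonctions `X`, `Y` sont invariantes par les translations de `F`");
Kohel 1996, §2.4] [cite: Velu1971] -/
theorem eval_veluN_mul_eq (hG : IsOddSubgroupFinset G) (h2 : (2 : K) ≠ 0) {x₁ y₁ x₂ y₂ : K}
    (h₁ : W.toAffine.Nonsingular x₁ y₁) (h₂ : W.toAffine.Nonsingular x₂ y₂) {u : W.toAffine.Point}
    (hu : u ∈ G) (hPu : some x₁ y₁ h₁ + u = some x₂ y₂ h₂)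
    (hgood₁ : ∀ v ∈ G.erase 0, xOf v ≠ x₁) (hgood₂ : ∀ v ∈ G.erase 0, xOf v ≠ x₂) :
    (veluN G).eval x₁ * (veluP₂ G).eval x₂ ^ 4 = (veluN G).eval x₂ * (veluP₂ G).eval x₁ ^ 4 := by
  -- the Vélu sums at `P` and at `P + u` agree
  have hsumx : ∑ v ∈ G, xOf (some x₂ y₂ h₂ + v) = ∑ v ∈ G, xOf (some x₁ y₁ h₁ + v) := by
    rw [← hPu]
    simp_rw [add_assoc]
    exact hG.sum_comp_add_left (fun v => xOf (some x₁ y₁ h₁ + v)) hu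
  have hsumy : ∑ v ∈ G, yOf (some x₂ y₂ h₂ + v) = ∑ v ∈ G, yOf (some x₁ y₁ h₁ + v) := by
    rw [← hPu]
    simp_rw [add_assoc]
    exact hG.sum_comp_add_left (fun v => yOf (some x₁ y₁ h₁ + v)) hu
  have hx₁ := veluP₂_mul_sum_xOf hG h2 h₁ hgood₁
  have hx₂ := veluP₂_mul_sum_xOf hG h2 h₂ hgood₂
  have hy₁ := veluP₂_sq_mul_sum_yOf hG h2 h₁ hgood₁
  have hy₂ := veluP₂_sq_mul_sum_yOf hG h2 h₂ hgood₂
  rw [hsumx] at hx₂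
  rw [hsumy] at hy₂
  set Sx := ∑ v ∈ G, xOf (some x₁ y₁ h₁ + v) - ∑ v ∈ G.erase 0, xOf v
  set Sy := ∑ v ∈ G, yOf (some x₁ y₁ h₁ + v)
  set p₁ := (veluP₂ G).eval x₁
  set p₂ := (veluP₂ G).eval x₂
  set U₁ := (veluU G).eval x₁
  set U₂ := (veluU G).eval x₂
  set S₁ := (veluS G).eval x₁
  set S₂ := (veluS G).eval x₂
  -- `α`: `U(x₁)P₂(x₂) = U(x₂)P₂(x₁)`, `β`: `y₁S(x₁)P₂(x₂)² = y₂S(x₂)P₂(x₁)²`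
  have hα : U₁ * p₂ = U₂ * p₁ := by linear_combination -p₂ * hx₁ + p₁ * hx₂
  have hβ : y₁ * S₁ * p₂ ^ 2 = y₂ * S₂ * p₁ ^ 2 := by linear_combination -p₂ ^ 2 * hy₁ + p₁ ^ 2 * hy₂
  have hN₁ := eval_veluN (G := G) x₁
  have hN₂ := eval_veluN (G := G) x₂
  have he₁ : (veluF W).eval x₁ = y₁ ^ 2 := by rw [eval_veluF, yOf_sq_eq h₁]
  have he₂ : (veluF W).eval x₂ = y₂ ^ 2 := by rw [eval_veluF, yOf_sq_eq h₂]
  rw [he₁] at hN₁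
  rw [he₂] at hN₂
  linear_combination p₂ ^ 4 * hN₁ - p₁ ^ 4 * hN₂ + (y₁ * S₁ * p₂ ^ 2 + y₂ * S₂ * p₁ ^ 2) * hβ -
    (p₁ * p₂ * ((U₁ * p₂) ^ 2 + U₁ * p₂ * (U₂ * p₁) + (U₂ * p₁) ^ 2) + veluA G * p₁ ^ 3 * p₂ ^ 3) * hα

end Invariance

/-! ### Base change of the kernel data along a field extension -/

section BaseChange

variable (W) {L : Type*} [Field L] [Algebra K L]

/-- The base change `W(K) → W(L)` on points (Mathlib's `Point.map` for the tower `K → K → L`;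
`W⁄K = W.baseChange K` has the same points as `W`). -/
local notation "mapL" => (map (W' := W) (Algebra.ofId K L))

/-- `x(v)` under base change. [folklore] -/
theorem xOf_map (v : (W⁄K).toAffine.Point) : xOf (mapL v) = algebraMap K L (xOf v) := by
  rcases v with _ | ⟨x, y, h⟩
  · change xOf (mapL 0) = algebraMap K L 0
    rw [map_zero, _root_.map_zero]; rfl
  · rw [map_some]; rfl

/-- `y(v)` under base change. [folklore] -/
theorem yOf_map (v : (W⁄K).toAffine.Point) : yOf (mapL v) = algebraMap K L (yOf v) := by
  rcases v with _ | ⟨x, y, h⟩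
  · change yOf (mapL 0) = algebraMap K L 0
    rw [map_zero, _root_.map_zero]; rfl
  · rw [map_some]; rfl

variable {G : Finset (W⁄K).toAffine.Point}

/-- The image of an odd subgroup finset is one. [folklore] -/
theorem IsOddSubgroupFinset.image (hG : IsOddSubgroupFinset G) : IsOddSubgroupFinset (G.image mapL) := by
  refine ⟨?_, ?_, ?_, ?_⟩
  · exact Finset.mem_image.mpr ⟨0, hG.zero_mem, map_zero _⟩
  · intro u hu v hv
    obtain ⟨u₀, hu₀, rfl⟩ := Finset.mem_image.mp hu
    obtain ⟨v₀, hv₀, rfl⟩ := Finset.mem_image.mp hv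
    exact Finset.mem_image.mpr ⟨u₀ + v₀, hG.add_mem _ hu₀ _ hv₀, _root_.map_add _ _ _⟩
  · intro v hv
    obtain ⟨v₀, hv₀, rfl⟩ := Finset.mem_image.mp hv
    exact Finset.mem_image.mpr ⟨-v₀, hG.neg_mem _ hv₀, _root_.map_neg _ _⟩
  · intro v hv h
    obtain ⟨v₀, hv₀, rfl⟩ := Finset.mem_image.mp hv
    rw [← _root_.map_neg] at h
    rw [hG.eq_zero_of_neg_eq _ hv₀ (map_injective _ h)]
    exact map_zero _

/-- Base change commutes with removing `O`. [folklore] -/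
theorem image_erase_zero : (G.image mapL).erase 0 = (G.erase 0).image mapL := by
  rw [Finset.image_erase (map_injective _), map_zero]

/-- `#(G ∖ O)` is invariant under base change. [folklore] -/
theorem card_image_erase_zero : ((G.image mapL).erase 0).card = (G.erase 0).card := by
  rw [image_erase_zero, Finset.card_image_of_injective _ (map_injective _)]

/-- `X - x(v)` under base change. [folklore] -/
theorem map_X_sub_C_xOf (v : (W⁄K).toAffine.Point) :
    (Polynomial.X - C (xOf v)).map (algebraMap K L) = Polynomial.X - C (xOf (mapL v)) := by
  rw [Polynomial.map_sub, map_X, map_C, xOf_map]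

/-- `P₂` commutes with base change. [folklore] -/
theorem veluP₂_image : veluP₂ (G.image mapL) = (veluP₂ G).map (algebraMap K L) := by
  rw [veluP₂, image_erase_zero, Finset.prod_image fun u _ v _ h => map_injective _ h, veluP₂,
    Polynomial.map_prod]
  exact Finset.prod_congr rfl fun v _ => (map_X_sub_C_xOf W v).symm

/-- `Q_v` commutes with base change. [folklore] -/
theorem veluQ_image (v : (W⁄K).toAffine.Point) :
    veluQ (G.image mapL) (mapL v) = (veluQ G v).map (algebraMap K L) := by
  have hset : (((G.image mapL).erase 0).erase (mapL v)).erase (-mapL v) =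
      (((G.erase 0).erase v).erase (-v)).image mapL := by
    rw [image_erase_zero, ← _root_.map_neg, ← Finset.image_erase (map_injective _),
      ← Finset.image_erase (map_injective _)]
  rw [veluQ, hset, Finset.prod_image fun u _ v _ h => map_injective _ h, veluQ, Polynomial.map_prod]
  exact Finset.prod_congr rfl fun v _ => (map_X_sub_C_xOf W v).symm

/-- `t_v` under base change. [folklore] -/
theorem veluT_map (v : (W⁄K).toAffine.Point) : veluT (mapL v) = algebraMap K L (veluT v) := by
  simp only [veluT, xOf_map, map_add, map_mul, map_pow, map_ofNat]; rfl

/-- `w_v` under base change. [folklore] -/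
theorem veluWc_map (v : (W⁄K).toAffine.Point) : veluWc (mapL v) = algebraMap K L (veluWc v) := by
  simp only [veluWc, xOf_map, map_add, map_mul, map_pow, map_neg, map_ofNat]; rfl

/-- `½` under base change. [folklore] -/
theorem map_C_two_inv : (C (2⁻¹ : K)).map (algebraMap K L) = C (2⁻¹ : L) := by
  rw [map_C, map_inv₀ (algebraMap K L), map_ofNat]

/-- `U₁` commutes with base change. [folklore] -/
theorem veluU₁_image : veluU₁ (G.image mapL) = (veluU₁ G).map (algebraMap K L) := by
  rw [veluU₁, image_erase_zero, Finset.sum_image fun u _ v _ h => map_injective _ h, veluU₁,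
    Polynomial.map_mul, map_C_two_inv, Polynomial.map_sum]
  congr 1
  refine Finset.sum_congr rfl fun v _ => ?_
  rw [Polynomial.map_mul, Polynomial.map_add, Polynomial.map_mul, map_C, map_C, map_X, veluT_map,
    veluWc_map, veluQ_image]

/-- `U` commutes with base change. [folklore] -/
theorem veluU_image : veluU (G.image mapL) = (veluU G).map (algebraMap K L) := by
  rw [veluU, veluU, Polynomial.map_add, Polynomial.map_mul, map_X, veluP₂_image, veluU₁_image]

/-- `S₁` commutes with base change. [folklore] -/
theorem veluS₁_image : veluS₁ (G.image mapL) = (veluS₁ G).map (algebraMap K L) := by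
  rw [veluS₁, image_erase_zero, Finset.sum_image fun u _ v _ h => map_injective _ h, veluS₁,
    Polynomial.map_mul, map_C_two_inv, Polynomial.map_sum]
  congr 1
  refine Finset.sum_congr rfl fun v _ => ?_
  rw [Polynomial.map_mul, Polynomial.map_mul, Polynomial.map_pow, Polynomial.map_add,
    Polynomial.map_mul, map_C, map_C, map_X, map_X_sub_C_xOf, veluQ_image, veluT_map, veluWc_map,
    xOf_map]
  simp only [map_neg, map_sub, map_mul, map_ofNat]

/-- `S` commutes with base change. [folklore] -/
theorem veluS_image : veluS (G.image mapL) = (veluS G).map (algebraMap K L) := by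
  rw [veluS, veluS, Polynomial.map_add, Polynomial.map_pow, veluP₂_image, veluS₁_image]

/-- `f` commutes with base change. [folklore] -/
theorem veluF_baseChange : veluF (W⁄L) = (veluF (W⁄K)).map (algebraMap K L) := by
  rw [veluF, veluF, Polynomial.map_add, Polynomial.map_add, Polynomial.map_mul, Polynomial.map_pow,
    map_X, map_C, map_C]
  rfl

/-- `M₁` commutes with base change. [folklore] -/
theorem veluM₁_image : veluM₁ (G.image mapL) = (veluM₁ G).map (algebraMap K L) := by
  rw [veluM₁, veluM₁, Polynomial.map_sub, Polynomial.map_mul, Polynomial.map_mul, Polynomial.map_pow,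
    Polynomial.map_pow, veluF_baseChange, veluS_image, veluP₂_image, veluU_image]

/-- `a'` commutes with base change. [folklore] -/
theorem veluA_image : veluA (G.image mapL) = algebraMap K L (veluA G) := by
  rw [veluA, veluA, card_image_erase_zero, veluM₁_image, coeff_map]

/-- `M` commutes with base change. [folklore] -/
theorem veluM_image : veluM (G.image mapL) = (veluM G).map (algebraMap K L) := by
  rw [veluM, veluM, Polynomial.map_sub, Polynomial.map_mul, Polynomial.map_mul, Polynomial.map_pow,
    map_C, veluM₁_image, veluA_image, veluU_image, veluP₂_image]

/-- `b'` commutes with base change. [folklore] -/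
theorem veluB_image : veluB (G.image mapL) = algebraMap K L (veluB G) := by
  rw [veluB, veluB, card_image_erase_zero, veluM_image, coeff_map]

/-- `N` commutes with base change. [folklore] -/
theorem veluN_image : veluN (G.image mapL) = (veluN G).map (algebraMap K L) := by
  rw [veluN, veluN, Polynomial.map_sub, Polynomial.map_mul, Polynomial.map_pow, map_C, veluM_image,
    veluB_image, veluP₂_image]

end BaseChange

end Subgroup

end WeierstrassCurve.Affine.Point

/-! ### The formal neighbourhood of `O`: `x(z) = z⁻²X(z)`, `X ≡ 1 (mod z⁴)`, and the expansion
### `x(T + u) = x(u) + 2y(u)·z + O(z²)` of a translate of the formal point -/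

namespace WeierstrassCurve

section FormalNeighbourhood

open PowerSeries

variable {F : Type*} [CommRing F] (W : WeierstrassCurve F) [W.IsShortNF]

/-- `w(z) = z³ + a₄z⁷ + ⋯`: for a short model `B = w/z³ ≡ 1 (mod z⁴)`. [Silverman AEC IV.1
(`w = z³(1 + A₁z + A₂z² + ⋯)`, `Aₙ = 0` for `n ≤ 3` when `a₁ = a₂ = a₃ = 0`)] [folklore] -/
theorem X_pow_four_dvd_formalWDivCube_sub_one : (X : F⟦X⟧) ^ 4 ∣ W.formalWDivCube - 1 := by
  have hfix := W.formalWStep_formalW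
  simp only [formalWStep, W.a₁_of_isShortNF, W.a₂_of_isShortNF, W.a₃_of_isShortNF, map_zero, zero_mul,
    add_zero, W.formalW_eq_X_pow_mul_formalWDivCube] at hfix
  set B := W.formalWDivCube
  refine ⟨C W.a₄ * B ^ 2 + C W.a₆ * X ^ 2 * B ^ 3, ?_⟩
  apply PowerSeries.X_pow_mul_cancel (k := 3)
  linear_combination -hfix

/-- **`x(z) = z⁻² + O(z²)` on a short model**: `X = z²x(z) ≡ 1 (mod z⁴)`. [Silverman AEC IV.1
(`x(z) = z⁻² - a₁z⁻¹ - a₂ - a₃z - (a₄ + a₁a₃)z² - ⋯`)] [folklore] -/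
theorem X_pow_four_dvd_formalXMulSq_sub_one : (X : F⟦X⟧) ^ 4 ∣ W.formalXMulSq - 1 := by
  obtain ⟨R, hR⟩ := W.X_pow_four_dvd_formalWDivCube_sub_one
  have hBX := W.formalWDivCube_mul_formalXMulSq
  refine ⟨-(R * W.formalXMulSq), ?_⟩
  linear_combination hBX - W.formalXMulSq * hR

/-- **The translate of the formal point, to second order.** For constants `r, s` let
`N = X - rz²` (`= z²(x - r)`, a unit), `Λ = -(X + sz³)·N⁻¹` (`= z·λ` for the chord slope
`λ = (y - s)/(x - r)` through the formal point `(x(z), y(z))` and `(r, s)`; `z³y = -X`). Then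
`Λ² - X - rz² = z²·Φ` with `Φ(0) = r`, `Φ'(0) = 2s`: the third point of intersection has
`x`-coordinate `λ² - x - r = Φ(z) = r + 2s·z + O(z²)` — the point `T + (r, s)` of the curve over
`F((z))` tends to `(r, s)` with velocity `2s = 2y` in `x`. [Silverman AEC III.2.3 (group law);
Vélu 1971 (expansions at the points of the kernel)] [folklore] -/
theorem exists_formalTranslateX (r s : F) :
    ∃ Φ : F⟦X⟧, (-(W.formalXMulSq + C s * X ^ 3) * (W.formalXMulSq - C r * X ^ 2).invOfUnit 1) ^ 2 -
        W.formalXMulSq - C r * X ^ 2 = X ^ 2 * Φ ∧ constantCoeff Φ = r ∧ coeff 1 Φ = 2 * s := by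
  set Xs := W.formalXMulSq with hXs
  set N := Xs - C r * X ^ 2 with hN
  set Ni := N.invOfUnit 1 with hNi
  set Λ := -(Xs + C s * X ^ 3) * Ni with hΛ
  have hX4 : (X : F⟦X⟧) ^ 4 ∣ Xs - 1 := W.X_pow_four_dvd_formalXMulSq_sub_one
  have hN0 : constantCoeff N = 1 := by
    rw [hN, map_sub, map_mul, map_pow, constantCoeff_X, zero_pow two_ne_zero, mul_zero, sub_zero, hXs,
      W.constantCoeff_formalXMulSq]
  have hNNi : N * Ni = 1 := mul_invOfUnit N 1 (by rw [hN0, Units.val_one])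
  clear_value Xs N Ni Λ
  -- `N⁻¹ ≡ 1 + rz² (mod z⁴)`
  have hNi4 : (X : F⟦X⟧) ^ 4 ∣ Ni - (1 + C r * X ^ 2) := by
    obtain ⟨R₀, hR₀⟩ := hX4
    have h1 : Ni - (1 + C r * X ^ 2) = X ^ 4 * (Ni * (C r ^ 2 - R₀ * (1 + C r * X ^ 2))) := by
      linear_combination (1 + C r * X ^ 2) * hNNi - (1 + C r * X ^ 2) * Ni * hN -
        (1 + C r * X ^ 2) * Ni * hR₀
    exact ⟨_, h1⟩
  -- `Λ ≡ -(1 + rz² + sz³) (mod z⁴)`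
  have hΛ4 : (X : F⟦X⟧) ^ 4 ∣ Λ + (1 + C r * X ^ 2 + C s * X ^ 3) := by
    have h1 : Λ + (1 + C r * X ^ 2 + C s * X ^ 3) =
        -((Xs + C s * X ^ 3) * (Ni - (1 + C r * X ^ 2)) + (Xs - 1) * (1 + C r * X ^ 2)) -
          X ^ 4 * (C r * C s * X) := by
      rw [hΛ]; ring
    rw [h1]
    exact dvd_sub (dvd_neg.mpr (dvd_add (dvd_mul_of_dvd_right hNi4 _) (dvd_mul_of_dvd_left hX4 _)))
      (dvd_mul_right _ _)
  -- `Λ² - X - rz² ≡ rz² + 2sz³ (mod z⁴)`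
  have hE4 : (X : F⟦X⟧) ^ 4 ∣ (Λ ^ 2 - Xs - C r * X ^ 2) - (C r * X ^ 2 + C (2 * s) * X ^ 3) := by
    have h1 : (Λ ^ 2 - Xs - C r * X ^ 2) - (C r * X ^ 2 + C (2 * s) * X ^ 3) =
        (Λ + (1 + C r * X ^ 2 + C s * X ^ 3)) * (Λ - (1 + C r * X ^ 2 + C s * X ^ 3)) - (Xs - 1) +
          X ^ 4 * (C r ^ 2 + 2 * C r * C s * X + C s ^ 2 * X ^ 2) := by
      rw [map_mul, map_ofNat]; ring
    rw [h1]
    exact dvd_add (dvd_sub (dvd_mul_of_dvd_left hΛ4 _) hX4) (dvd_mul_right _ _)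
  -- read off the coefficients `0, 1, 2, 3`
  have hcoeff : ∀ d < 4, coeff d (Λ ^ 2 - Xs - C r * X ^ 2) = coeff d (C r * X ^ 2 + C (2 * s) * X ^ 3) := by
    intro d hd
    have h := (PowerSeries.X_pow_dvd_iff.mp hE4) d hd
    rwa [map_sub, sub_eq_zero] at h
  have hc0 : coeff 0 (Λ ^ 2 - Xs - C r * X ^ 2) = 0 := by
    rw [hcoeff 0 (by norm_num)]; simp only [map_add, coeff_C_mul, coeff_X_pow]; norm_num
  have hc1 : coeff 1 (Λ ^ 2 - Xs - C r * X ^ 2) = 0 := by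
    rw [hcoeff 1 (by norm_num)]; simp only [map_add, coeff_C_mul, coeff_X_pow]; norm_num
  have hc2 : coeff 2 (Λ ^ 2 - Xs - C r * X ^ 2) = r := by
    rw [hcoeff 2 (by norm_num)]; simp only [map_add, coeff_C_mul, coeff_X_pow]; norm_num
  have hc3 : coeff 3 (Λ ^ 2 - Xs - C r * X ^ 2) = 2 * s := by
    rw [hcoeff 3 (by norm_num)]; simp only [map_add, coeff_C_mul, coeff_X_pow]; norm_num
  obtain ⟨Φ, hΦ⟩ : (X : F⟦X⟧) ^ 2 ∣ Λ ^ 2 - Xs - C r * X ^ 2 := by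
    refine PowerSeries.X_pow_dvd_iff.mpr fun d hd => ?_
    interval_cases d
    · exact hc0
    · exact hc1
  refine ⟨Φ, hΦ, ?_, ?_⟩
  · have h := hc2
    rwa [hΦ, coeff_X_pow_mul', if_pos le_rfl, Nat.sub_self, coeff_zero_eq_constantCoeff_apply] at h
  · have h := hc3
    rwa [hΦ, coeff_X_pow_mul', if_pos (by norm_num), show 3 - 2 = 1 from rfl] at h

omit [W.IsShortNF] in
/-- The key identity behind the chord slope through the formal point: `Λ·N = -(X + sz³)`,
i.e. `(zλ)·z²(x - r) = z³(y - s)`. [folklore] -/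
theorem formalSlope_mul (r s : F) :
    (-(W.formalXMulSq + C s * X ^ 3) * (W.formalXMulSq - C r * X ^ 2).invOfUnit 1) *
      (W.formalXMulSq - C r * X ^ 2) = -(W.formalXMulSq + C s * X ^ 3) := by
  have hN0 : constantCoeff (W.formalXMulSq - C r * X ^ 2) = 1 := by
    rw [map_sub, map_mul, map_pow, constantCoeff_X, zero_pow two_ne_zero, mul_zero, sub_zero,
      W.constantCoeff_formalXMulSq]
  have h := mul_invOfUnit (W.formalXMulSq - C r * X ^ 2) 1 (by rw [hN0, Units.val_one])
  linear_combination (-(W.formalXMulSq + C s * X ^ 3)) * h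

/-- The Weierstrass equation of the short model in `X = z²x`: `X² = X³ + a₄z⁴X + a₆z⁶`
(`z⁶·(y² = x³ + a₄x + a₆)`, `z³y = -X`). [Silverman AEC IV.1] [folklore] -/
theorem formalXMulSq_sq_eq_of_isShortNF :
    W.formalXMulSq ^ 2 = W.formalXMulSq ^ 3 + C W.a₄ * X ^ 4 * W.formalXMulSq + C W.a₆ * X ^ 6 := by
  have h := W.formalXMulSq_sq_eq
  rw [W.a₁_of_isShortNF, W.a₂_of_isShortNF, W.a₃_of_isShortNF, map_zero] at h
  linear_combination h

end FormalNeighbourhood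

/-- Short models are preserved by base change. [folklore] -/
instance instIsShortNFMap {R S : Type*} [CommRing R] [CommRing S] (W : WeierstrassCurve R)
    [W.IsShortNF] (φ : R →+* S) : (W.map φ).IsShortNF :=
  ⟨by simp, by simp, by simp⟩

/-- Short models are preserved by base change. [folklore] -/
instance instIsShortNFBaseChange {R S : Type*} [CommRing R] [CommRing S] [Algebra R S]
    (W : WeierstrassCurve R) [W.IsShortNF] : (W⁄S).IsShortNF :=
  instIsShortNFMap W (algebraMap R S)

/-! ### The formal point `T = (x(z), y(z))` over `F((z))` and Vélu's theorem -/

section LaurentPoint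

open PowerSeries Affine Affine.Point
open scoped LaurentSeries

variable {F : Type*} [Field F] (W : WeierstrassCurve F) [W.IsShortNF] [W.IsElliptic]

local notation "𝓛" => LaurentSeries F
local notation "ιL" => (HahnSeries.ofPowerSeries ℤ F)

/-- The tower `F → F → F((z))` for Mathlib's algebra structure on Laurent series (needed by
`Point.map`; stated for the `Algebra.toSMul` actions to avoid the `HahnSeries` scalar-action
diamond). [folklore] -/
instance instIsScalarTowerLaurent :
    @IsScalarTower F F 𝓛 Algebra.toSMul Algebra.toSMul Algebra.toSMul :=
  IsScalarTower.of_algebraMap_eq fun _ => rfl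

omit [W.IsShortNF] [W.IsElliptic] in
/-- Constants of `F((z))` are constant power series. [folklore] -/
theorem algebraMap_laurent_eq (r : F) : algebraMap F 𝓛 r = ιL (PowerSeries.C r) := rfl

omit [W.IsShortNF] [W.IsElliptic] in
/-- `z ≠ 0` in `F((z))`. [folklore] -/
theorem ofPowerSeries_X_ne_zero : (ιL PowerSeries.X : 𝓛) ≠ 0 := fun h =>
  PowerSeries.X_ne_zero (HahnSeries.ofPowerSeries_injective (h.trans (_root_.map_zero _).symm))

omit [W.IsShortNF] [W.IsElliptic] in
/-- Evaluating a base-changed polynomial at the image of a power series. [folklore] -/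
theorem eval_map_ofPowerSeries (p : Polynomial F) (G : F⟦X⟧) :
    (p.map (algebraMap F 𝓛)).eval (ιL G) = ιL (Polynomial.aeval G p) := by
  rw [Polynomial.eval_map, Polynomial.aeval_def, Polynomial.hom_eval₂]
  rfl

omit [W.IsShortNF] [W.IsElliptic] in
/-- The constant term of `p(G(z))` is `p(G(0))`. [folklore] -/
theorem constantCoeff_aeval (p : Polynomial F) (G : F⟦X⟧) :
    constantCoeff (Polynomial.aeval G p) = p.eval (constantCoeff G) := by
  rw [Polynomial.aeval_def, Polynomial.hom_eval₂, Polynomial.eval]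
  congr 1

omit [W.IsShortNF] [W.IsElliptic] in
/-- **`p(x(z)) = z^{-2e}·ev_e(p)`** for `deg p ≤ e` (`x(z) = z⁻²X`), read in `F((z))`:
`p̃(X·z⁻²)·z^{2e} = ev_e(p)`. [Blakestad–Grant 2023, §2 eq. (2)] [folklore] -/
theorem eval_map_formalX_mul (p : Polynomial F) {e : ℕ} (hp : p.natDegree ≤ e) :
    (p.map (algebraMap F 𝓛)).eval (ιL W.formalXMulSq * (ιL PowerSeries.X)⁻¹ ^ 2) *
        (ιL PowerSeries.X) ^ (2 * e) = ιL (W.clearedEval e p) := by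
  have ht := ofPowerSeries_X_ne_zero (F := F)
  rw [W.clearedEval_eq_sum hp, Polynomial.eval_map, Polynomial.eval₂_eq_sum_range' (algebraMap F 𝓛)
    (Nat.lt_succ_of_le hp), Finset.sum_mul, map_sum]
  refine Finset.sum_congr rfl fun k hk => ?_
  have hk' : k ≤ e := Nat.lt_succ_iff.mp (Finset.mem_range.mp hk)
  rw [map_mul, map_mul, map_pow, map_pow, ← algebraMap_laurent_eq, mul_pow, ← pow_mul,
    show 2 * e = 2 * k + 2 * (e - k) by omega, pow_add, pow_mul]
  have hinv : ((ιL PowerSeries.X)⁻¹ ^ 2) ^ k * (ιL PowerSeries.X) ^ (2 * k) = 1 := by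
    rw [← pow_mul, ← mul_pow, inv_mul_cancel₀ ht, one_pow]
  linear_combination (algebraMap F 𝓛) (p.coeff k) * (ιL W.formalXMulSq) ^ k *
    (ιL PowerSeries.X) ^ (2 * (e - k)) * hinv

omit [W.IsElliptic] in
/-- **The formal point `T = (x(z), y(z)) ∈ W(F((z)))`**: `x = z⁻²X`, `y = -z⁻³X` satisfy the
(short) Weierstrass equation. [Silverman AEC IV.1 (the Laurent series `x(z)`, `y(z)` give a point
of `E` over the field of Laurent series)] [folklore] -/
theorem equation_formalPoint :
    (W⁄𝓛).toAffine.Equation (ιL W.formalXMulSq * (ιL PowerSeries.X)⁻¹ ^ 2)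
      (-(ιL W.formalXMulSq) * (ιL PowerSeries.X)⁻¹ ^ 3) := by
  have ht := ofPowerSeries_X_ne_zero (F := F)
  have hinv : (ιL PowerSeries.X)⁻¹ * (ιL PowerSeries.X) = 1 := inv_mul_cancel₀ ht
  have h := congrArg (HahnSeries.ofPowerSeries ℤ F) W.formalXMulSq_sq_eq_of_isShortNF
  simp only [map_pow, map_add, map_mul] at h
  rw [← algebraMap_laurent_eq, ← algebraMap_laurent_eq] at h
  rw [Affine.equation_iff]
  have ha1 : (W⁄𝓛).toAffine.a₁ = 0 := by
    show algebraMap F 𝓛 W.a₁ = 0; rw [W.a₁_of_isShortNF, _root_.map_zero]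
  have ha2 : (W⁄𝓛).toAffine.a₂ = 0 := by
    show algebraMap F 𝓛 W.a₂ = 0; rw [W.a₂_of_isShortNF, _root_.map_zero]
  have ha3 : (W⁄𝓛).toAffine.a₃ = 0 := by
    show algebraMap F 𝓛 W.a₃ = 0; rw [W.a₃_of_isShortNF, _root_.map_zero]
  have ha4 : (W⁄𝓛).toAffine.a₄ = algebraMap F 𝓛 W.a₄ := rfl
  have ha6 : (W⁄𝓛).toAffine.a₆ = algebraMap F 𝓛 W.a₆ := rfl
  rw [ha1, ha2, ha3, ha4, ha6]
  simp only [zero_mul, add_zero]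
  -- multiply `h` by `z⁻⁶`
  have h4 : (ιL PowerSeries.X)⁻¹ ^ 2 = (ιL PowerSeries.X)⁻¹ ^ 6 * (ιL PowerSeries.X) ^ 4 := by
    linear_combination (-((ιL PowerSeries.X)⁻¹ ^ 5 * (ιL PowerSeries.X) ^ 3) -
      (ιL PowerSeries.X)⁻¹ ^ 4 * (ιL PowerSeries.X) ^ 2 - (ιL PowerSeries.X)⁻¹ ^ 3 * (ιL PowerSeries.X) -
      (ιL PowerSeries.X)⁻¹ ^ 2) * hinv
  have h6 : (1 : 𝓛) = (ιL PowerSeries.X)⁻¹ ^ 6 * (ιL PowerSeries.X) ^ 6 := by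
    linear_combination (-((ιL PowerSeries.X)⁻¹ ^ 5 * (ιL PowerSeries.X) ^ 5) -
      (ιL PowerSeries.X)⁻¹ ^ 4 * (ιL PowerSeries.X) ^ 4 - (ιL PowerSeries.X)⁻¹ ^ 3 * (ιL PowerSeries.X) ^ 3 -
      (ιL PowerSeries.X)⁻¹ ^ 2 * (ιL PowerSeries.X) ^ 2 - (ιL PowerSeries.X)⁻¹ * (ιL PowerSeries.X) - 1) * hinv
  linear_combination (ιL PowerSeries.X)⁻¹ ^ 6 * h -
    algebraMap F 𝓛 W.a₄ * (ιL W.formalXMulSq) * h4 - algebraMap F 𝓛 W.a₆ * h6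

/-- The formal point is nonsingular (the curve is elliptic). [folklore] -/
theorem nonsingular_formalPoint :
    (W⁄𝓛).toAffine.Nonsingular (ιL W.formalXMulSq * (ιL PowerSeries.X)⁻¹ ^ 2)
      (-(ιL W.formalXMulSq) * (ιL PowerSeries.X)⁻¹ ^ 3) :=
  (Affine.equation_iff_nonsingular (W := (W⁄𝓛).toAffine)).mp W.equation_formalPoint

omit [W.IsShortNF] [W.IsElliptic] in
/-- `x(z)` is not a constant. [folklore] -/
theorem formalX_ne_algebraMap (r : F) :
    ιL W.formalXMulSq * (ιL PowerSeries.X)⁻¹ ^ 2 ≠ algebraMap F 𝓛 r := by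
  intro h
  have ht := ofPowerSeries_X_ne_zero (F := F)
  have h1 : ιL W.formalXMulSq = ιL (PowerSeries.C r * PowerSeries.X ^ 2) := by
    rw [map_mul, map_pow, ← algebraMap_laurent_eq, ← h]
    field_simp
  have h2 := congrArg constantCoeff (HahnSeries.ofPowerSeries_injective h1)
  rw [W.constantCoeff_formalXMulSq, map_mul, map_pow, constantCoeff_X, zero_pow two_ne_zero,
    mul_zero] at h2
  exact one_ne_zero h2

omit [W.IsShortNF] [W.IsElliptic] in
/-- A power series with non-zero linear coefficient is not a constant. [folklore] -/
theorem ofPowerSeries_ne_algebraMap {G : F⟦X⟧} (hG : coeff 1 G ≠ 0) (r : F) :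
    ιL G ≠ algebraMap F 𝓛 r := by
  intro h
  rw [algebraMap_laurent_eq] at h
  have h2 := congrArg (coeff 1) (HahnSeries.ofPowerSeries_injective h)
  rw [coeff_C, if_neg one_ne_zero] at h2
  exact hG h2

/-- **The translate `T + u` of the formal point by `u = (r, s) ∈ W(F)`** has `x`-coordinate the
power series `Φ_u(z) = r + 2s·z + O(z²)` of `exists_formalTranslateX`.
[Silverman AEC III.2.3; Vélu 1971] [folklore] -/
theorem exists_formalPoint_add_eq {r s : F} (hrs : (W⁄F).toAffine.Nonsingular r s) :
    ∃ (Φ : F⟦X⟧) (y' : 𝓛) (h' : (W⁄𝓛).toAffine.Nonsingular (ιL Φ) y'),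
      constantCoeff Φ = r ∧ coeff 1 Φ = 2 * s ∧
      Point.some _ _ W.nonsingular_formalPoint + Point.map (Algebra.ofId F 𝓛) (Point.some r s hrs) =
        Point.some (ιL Φ) y' h' := by
  obtain ⟨Φ, hΦ, hΦ0, hΦ1⟩ := W.exists_formalTranslateX r s
  have hΛN := W.formalSlope_mul r s
  have ht := ofPowerSeries_X_ne_zero (F := F)
  have hinv : (ιL PowerSeries.X)⁻¹ * (ιL PowerSeries.X) = 1 := inv_mul_cancel₀ ht
  have hofId : ∀ a : F, (Algebra.ofId F 𝓛) a = ιL (PowerSeries.C a) := fun _ => rfl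
  have hx : ιL W.formalXMulSq * (ιL PowerSeries.X)⁻¹ ^ 2 ≠ (Algebra.ofId F 𝓛) r :=
    W.formalX_ne_algebraMap r
  rw [Point.map_some, add_of_X_ne hx]
  -- transport of the nonsingularity proof along an equality of `x`-coordinates
  have key : ∀ {x₁ x₂ : 𝓛} (y : 𝓛) (h₁ : (W⁄𝓛).toAffine.Nonsingular x₁ y) (e : x₁ = x₂),
      ∃ h₂ : (W⁄𝓛).toAffine.Nonsingular x₂ y, Point.some x₁ y h₁ = Point.some x₂ y h₂ := by
    intro x₁ x₂ y h₁ e; subst e; exact ⟨h₁, rfl⟩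
  -- the slope is `z⁻¹·Λ`, `Λ = -(X + sz³)·(X - rz²)⁻¹`
  have hslope : (W⁄𝓛).toAffine.slope (ιL W.formalXMulSq * (ιL PowerSeries.X)⁻¹ ^ 2)
      ((Algebra.ofId F 𝓛) r) (-(ιL W.formalXMulSq) * (ιL PowerSeries.X)⁻¹ ^ 3) ((Algebra.ofId F 𝓛) s) =
      ιL (-(W.formalXMulSq + PowerSeries.C s * PowerSeries.X ^ 3)) *
        ιL ((W.formalXMulSq - PowerSeries.C r * PowerSeries.X ^ 2).invOfUnit 1) * (ιL PowerSeries.X)⁻¹ := by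
    rw [Affine.slope_of_X_ne hx, div_eq_iff (sub_ne_zero.mpr hx), hofId, hofId]
    have h := congrArg (HahnSeries.ofPowerSeries ℤ F) hΛN
    simp only [map_mul, map_neg, map_add, map_sub, map_pow] at h ⊢
    linear_combination (-((ιL PowerSeries.X)⁻¹ ^ 3)) * h +
      (ιL (PowerSeries.C s) * ((ιL PowerSeries.X)⁻¹ ^ 2 * (ιL PowerSeries.X) ^ 2 +
        (ιL PowerSeries.X)⁻¹ * (ιL PowerSeries.X) + 1) +
       (ιL W.formalXMulSq + ιL (PowerSeries.C s) * (ιL PowerSeries.X) ^ 3) *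
        ιL ((W.formalXMulSq - PowerSeries.C r * PowerSeries.X ^ 2).invOfUnit 1) * (ιL PowerSeries.X)⁻¹ *
        ιL (PowerSeries.C r) * ((ιL PowerSeries.X)⁻¹ * (ιL PowerSeries.X) + 1)) * hinv
  -- the new `x`-coordinate is `Λ²z⁻² - x - r = Φ`
  have ha1 : (W⁄𝓛).toAffine.a₁ = 0 := by
    show algebraMap F 𝓛 W.a₁ = 0; rw [W.a₁_of_isShortNF, _root_.map_zero]
  have ha2 : (W⁄𝓛).toAffine.a₂ = 0 := by
    show algebraMap F 𝓛 W.a₂ = 0; rw [W.a₂_of_isShortNF, _root_.map_zero]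
  have hX : (W⁄𝓛).toAffine.addX (ιL W.formalXMulSq * (ιL PowerSeries.X)⁻¹ ^ 2) ((Algebra.ofId F 𝓛) r)
      ((W⁄𝓛).toAffine.slope (ιL W.formalXMulSq * (ιL PowerSeries.X)⁻¹ ^ 2) ((Algebra.ofId F 𝓛) r)
        (-(ιL W.formalXMulSq) * (ιL PowerSeries.X)⁻¹ ^ 3) ((Algebra.ofId F 𝓛) s)) = ιL Φ := by
    rw [Affine.addX, hslope, hofId, ha1, ha2, zero_mul, add_zero, sub_zero]
    have h := congrArg (HahnSeries.ofPowerSeries ℤ F) hΦ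
    simp only [map_mul, map_neg, map_add, map_sub, map_pow] at h ⊢
    have h2 : (1 : 𝓛) = (ιL PowerSeries.X)⁻¹ ^ 2 * (ιL PowerSeries.X) ^ 2 := by
      linear_combination (-((ιL PowerSeries.X)⁻¹ * (ιL PowerSeries.X)) - 1) * hinv
    linear_combination (ιL PowerSeries.X)⁻¹ ^ 2 * h - (ιL (PowerSeries.C r) + ιL Φ) * h2
  have hmapped : (W⁄𝓛).toAffine.Nonsingular ((Algebra.ofId F 𝓛) r) ((Algebra.ofId F 𝓛) s) :=
    (Affine.map_nonsingular (W := (W⁄F).toAffine) (f := algebraMap F 𝓛) (algebraMap F 𝓛).injective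
      r s).mpr hrs
  obtain ⟨h₂, e₂⟩ := key _ (nonsingular_add W.nonsingular_formalPoint hmapped fun hxy => hx hxy.left) hX
  exact ⟨Φ, _, h₂, hΦ0, hΦ1, e₂⟩

/-! ### Vélu's theorem: `N = 0` -/

variable {W}

omit [W.IsShortNF] [W.IsElliptic] in
/-- In characteristic zero, `2 ≠ 0` in `F((z))`. [folklore] -/
theorem two_ne_zero_laurent [CharZero F] : (2 : 𝓛) ≠ 0 := by
  rw [show (2 : 𝓛) = algebraMap F 𝓛 2 by rw [map_ofNat]]
  exact fun h => two_ne_zero ((algebraMap F 𝓛).injective (h.trans (_root_.map_zero _).symm))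

/-- **The heart of the proof**: every `x`-coordinate `r = x(u)`, `u ∈ G ∖ O`, is a root of `N` of
multiplicity `≥ 10` (if `N ≠ 0`, `m = #(G ∖ O) ≥ 1`). Evaluate the `G`-invariant `N/P₂⁴` at the
formal point `T` and at `T + u`: `N(x(T))/P₂(x(T))⁴ = O(z²)` since `deg N ≤ 4m - 1` while
`P₂(x(T)) ∼ z^{-2m}`; on the other side `x(T + u) = r + 2y(u)z + ⋯` has a SIMPLE zero against
`X - r` (`y(u) ≠ 0`: no `2`-torsion), so `P₂(x(T+u)) ∼ z²` and `N(x(T+u)) ∼ z^k`,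
`k = mult_r(N)`; comparing, `k - 8 ≥ 2`. [Vélu 1971; Kohel 1996, §2.4 (Vélu's formulae); this
argument replaces the analysis of the poles of `y'² - f'(x')` at the points of the kernel]
[cite: Velu1971] -/
theorem X_sub_C_pow_ten_dvd_veluN [CharZero F] {G : Finset (W⁄F).toAffine.Point} (hG : IsOddSubgroupFinset G)
    (hN : veluN G ≠ 0) (hm : 1 ≤ (G.erase 0).card) {u : (W⁄F).toAffine.Point} (hu : u ∈ G.erase 0) :
    (Polynomial.X - Polynomial.C (xOf u)) ^ 10 ∣ veluN G := by
  have ht := ofPowerSeries_X_ne_zero (F := F)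
  have hu0 : u ≠ 0 := (Finset.mem_erase.mp hu).1
  have huG : u ∈ G := (Finset.mem_erase.mp hu).2
  rcases u with _ | ⟨r, s, hrs⟩
  · exact (hu0 rfl).elim
  rw [xOf_some]
  -- `s ≠ 0` (no `2`-torsion)
  have hs : s ≠ 0 := by
    intro hs0
    refine hu0 (hG.eq_zero_of_neg_eq _ huG ?_)
    rw [neg_some]
    congr 1
    rw [negY_of_isShortNF, hs0, _root_.neg_zero]
  have hs2 : (2 : F) * s ≠ 0 := mul_ne_zero two_ne_zero hs
  -- the translate `T + u` over `F((z))`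
  obtain ⟨Φ, y', h', hΦ0, hΦ1, hTu⟩ := W.exists_formalPoint_add_eq hrs
  set G' := G.image (Point.map (W' := W) (Algebra.ofId F 𝓛)) with hG'
  have hG'odd : IsOddSubgroupFinset G' := hG.image W
  have hu' : Point.map (W' := W) (Algebra.ofId F 𝓛) (Point.some r s hrs) ∈ G' :=
    Finset.mem_image_of_mem _ huG
  -- both points avoid the `x`-coordinates of the kernel
  have hgood₁ : ∀ w ∈ G'.erase 0, xOf w ≠ ιL W.formalXMulSq * (ιL PowerSeries.X)⁻¹ ^ 2 := by
    intro w hw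
    rw [hG', image_erase_zero] at hw
    obtain ⟨v, -, rfl⟩ := Finset.mem_image.mp hw
    rw [xOf_map]
    exact (W.formalX_ne_algebraMap _).symm
  have hgood₂ : ∀ w ∈ G'.erase 0, xOf w ≠ ιL Φ := by
    intro w hw
    rw [hG', image_erase_zero] at hw
    obtain ⟨v, -, rfl⟩ := Finset.mem_image.mp hw
    rw [xOf_map]
    exact (ofPowerSeries_ne_algebraMap (by rw [hΦ1]; exact hs2) _).symm
  -- `G`-invariance of `N/P₂⁴` between `T` and `T + u`, read over `F((z))`
  have hinv := eval_veluN_mul_eq hG'odd two_ne_zero_laurent W.nonsingular_formalPoint h' hu' hTu hgood₁ hgood₂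
  rw [veluN_image, veluP₂_image, eval_map_ofPowerSeries, eval_map_ofPowerSeries] at hinv
  -- clear the poles: multiply by `z^{2e + 8m}`, `e = 4m - 1`
  set m := (G.erase 0).card with hmdef
  set e := 4 * m - 1 with hedef
  have hNdeg : (veluN G).natDegree ≤ e := natDegree_veluN_le hG hm
  have hP₂deg : (veluP₂ G).natDegree ≤ m := natDegree_veluP₂.le
  have hevN := W.eval_map_formalX_mul (veluN G) hNdeg
  have hevP := W.eval_map_formalX_mul (veluP₂ G) hP₂deg
  have key : ιL (W.clearedEval e (veluN G) * Polynomial.aeval Φ (veluP₂ G) ^ 4 * PowerSeries.X ^ (8 * m)) =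
      ιL (Polynomial.aeval Φ (veluN G) * W.clearedEval m (veluP₂ G) ^ 4 * PowerSeries.X ^ (2 * e)) := by
    rw [map_mul, map_mul, map_pow, map_pow, map_mul, map_mul, map_pow, map_pow, ← hevN, ← hevP]
    have h8 : (ιL PowerSeries.X) ^ (8 * m) = ((ιL PowerSeries.X) ^ (2 * m)) ^ 4 := by
      rw [← pow_mul]; congr 1; ring
    rw [h8]
    linear_combination (ιL PowerSeries.X) ^ (2 * e) * ((ιL PowerSeries.X) ^ (2 * m)) ^ 4 * hinv
  have keyPS := HahnSeries.ofPowerSeries_injective key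
  -- factor `N = (X - r)^k N₁`, `P₂ = (X - r)² Q_u`, `Φ - r = z·E`
  set k := (veluN G).rootMultiplicity r with hkdef
  obtain ⟨N₁, hNfac, hN₁⟩ := (veluN G).exists_eq_pow_rootMultiplicity_mul_and_not_dvd hN r
  have hN₁r : N₁.eval r ≠ 0 := fun h0 => hN₁ (Polynomial.dvd_iff_isRoot.mpr h0)
  have hP₂fac := sq_mul_veluQ hG hu
  rw [xOf_some] at hP₂fac
  obtain ⟨E, hE⟩ : (PowerSeries.X : F⟦X⟧) ∣ Φ - PowerSeries.C r := by
    rw [PowerSeries.X_dvd_iff, map_sub, hΦ0, constantCoeff_C, sub_self]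
  have hE0 : constantCoeff E ≠ 0 := by
    have h1 := congrArg (coeff 1) hE
    rw [map_sub, coeff_C, if_neg one_ne_zero, sub_zero, hΦ1, coeff_succ_X_mul,
      coeff_zero_eq_constantCoeff_apply] at h1
    rw [← h1]; exact hs2
  have hQr : (veluQ G (Point.some r s hrs)).eval r ≠ 0 := by
    rw [veluQ, Polynomial.eval_prod]
    refine Finset.prod_ne_zero_iff.mpr fun v hv => ?_
    rw [Polynomial.eval_sub, Polynomial.eval_X, Polynomial.eval_C]
    refine sub_ne_zero.mpr fun hrv => ?_
    have hv' := Finset.mem_erase.mp hv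
    have hv'' := Finset.mem_erase.mp hv'.2
    have hv0 : v ≠ 0 := (Finset.mem_erase.mp hv''.2).1
    rcases eq_or_eq_neg_of_xOf_eq hv0 hu0 hrv.symm with h | h
    · exact hv''.1 h
    · exact hv'.1 h
  have hevP0 : constantCoeff (W.clearedEval m (veluP₂ G)) = 1 := by
    rw [W.constantCoeff_clearedEval hP₂deg, hmdef, ← natDegree_veluP₂ (G := G)]
    exact monic_veluP₂.coeff_natDegree
  -- substitute the factorisations
  have hCr : Polynomial.aeval Φ (Polynomial.X - Polynomial.C r) = PowerSeries.X * E := by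
    rw [map_sub, Polynomial.aeval_X, Polynomial.aeval_C, ← hE]
    simp
  have haevN : Polynomial.aeval Φ (veluN G) = PowerSeries.X ^ k * (E ^ k * Polynomial.aeval Φ N₁) := by
    conv_lhs => rw [hNfac]
    rw [map_mul, map_pow, hCr]
    ring
  have haevP : Polynomial.aeval Φ (veluP₂ G) = PowerSeries.X ^ 2 * (E ^ 2 * Polynomial.aeval Φ (veluQ G (Point.some r s hrs))) := by
    conv_lhs => rw [← hP₂fac]
    rw [map_mul, map_pow, hCr]
    ring
  rw [haevN, haevP] at keyPS
  -- `z^{8m+8}·A = z^{k+2e}·B` with `B(0) ≠ 0`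
  have hB0 : constantCoeff (E ^ k * Polynomial.aeval Φ N₁ * W.clearedEval m (veluP₂ G) ^ 4) ≠ 0 := by
    rw [map_mul, map_mul, map_pow, map_pow, hevP0, one_pow, mul_one, constantCoeff_aeval, hΦ0]
    exact mul_ne_zero (pow_ne_zero _ hE0) hN₁r
  have hshape : PowerSeries.X ^ (8 * m + 8) *
      (W.clearedEval e (veluN G) * (E ^ 2 * Polynomial.aeval Φ (veluQ G (Point.some r s hrs))) ^ 4) =
      PowerSeries.X ^ (k + 2 * e) * (E ^ k * Polynomial.aeval Φ N₁ * W.clearedEval m (veluP₂ G) ^ 4) := by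
    rw [pow_add, pow_add]
    linear_combination keyPS
  -- compare the coefficients of `z^{k+2e}`
  have hk : 8 * m + 8 ≤ k + 2 * e := by
    by_contra hlt
    push Not at hlt
    have h := congrArg (coeff (k + 2 * e)) hshape
    rw [coeff_X_pow_mul', coeff_X_pow_mul', if_neg (not_le.mpr hlt), if_pos le_rfl, Nat.sub_self,
      coeff_zero_eq_constantCoeff] at h
    exact hB0 h.symm
  have hk10 : 10 ≤ k := by omega
  calc (Polynomial.X - Polynomial.C r) ^ 10 ∣ (Polynomial.X - Polynomial.C r) ^ k := pow_dvd_pow _ hk10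
    _ ∣ veluN G := Dvd.intro _ hNfac.symm

/-- `N = 0` when `G = O` (then `U = X`, `S = P₂ = 1`, `a' = a₄`, `b' = a₆`). [folklore] -/
theorem veluN_eq_zero_of_erase_eq_empty {K : Type*} [Field K] {V : WeierstrassCurve K}
    {G : Finset V.toAffine.Point} (h : G.erase 0 = ∅) : veluN G = 0 := by
  have hP : veluP₂ G = 1 := by rw [veluP₂, h, Finset.prod_empty]
  have hU : veluU G = Polynomial.X := by
    rw [veluU, hP, mul_one, veluU₁, h, Finset.sum_empty, mul_zero, add_zero]
  have hS : veluS G = 1 := by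
    rw [veluS, hP, one_pow, veluS₁, h, Finset.sum_empty, mul_zero, add_zero]
  have hM₁ : veluM₁ G = Polynomial.C V.a₄ * Polynomial.X + Polynomial.C V.a₆ := by
    rw [veluM₁, hS, hP, hU, veluF]; ring
  have hm : (G.erase 0).card = 0 := by rw [h, Finset.card_empty]
  have hA : veluA G = V.a₄ := by
    rw [veluA, hm, hM₁]; simp
  have hM : veluM G = Polynomial.C V.a₆ := by
    rw [veluM, hM₁, hA, hU, hP]; ring
  have hB : veluB G = V.a₆ := by
    rw [veluB, hm, hM]; simp
  rw [veluN, hM, hB, hP]; ring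

omit [W.IsShortNF] [W.IsElliptic] in
/-- Fibres of `x` on `G ∖ O` have at most two elements. [folklore] -/
theorem card_filter_xOf_le_two {G : Finset (W⁄F).toAffine.Point} (a : F) :
    ((G.erase 0).filter fun v => xOf v = a).card ≤ 2 := by
  by_contra h
  push Not at h
  obtain ⟨v, hv, w, hw, hvw⟩ := Finset.one_lt_card.mp (by omega : 1 < ((G.erase 0).filter fun v => xOf v = a).card)
  obtain ⟨hv1, hv2⟩ := Finset.mem_filter.mp hv
  obtain ⟨hw1, hw2⟩ := Finset.mem_filter.mp hw
  have hv0 := (Finset.mem_erase.mp hv1).1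
  have hw0 := (Finset.mem_erase.mp hw1).1
  -- a third element
  obtain ⟨z, hz, hzv, hzw⟩ : ∃ z ∈ (G.erase 0).filter (fun v => xOf v = a), z ≠ v ∧ z ≠ w := by
    have h3 : 2 < (((G.erase 0).filter fun v => xOf v = a)).card := h
    obtain ⟨z, hz, hz'⟩ := Finset.exists_mem_notMem_of_card_lt_card
      (s := ({v, w} : Finset _)) (t := (G.erase 0).filter fun v => xOf v = a)
      (lt_of_le_of_lt (Finset.card_le_two) h3)
    refine ⟨z, hz, ?_, ?_⟩ <;> intro hh <;> apply hz' <;> simp [hh]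
  obtain ⟨hz1, hz2⟩ := Finset.mem_filter.mp hz
  have hz0 := (Finset.mem_erase.mp hz1).1
  rcases eq_or_eq_neg_of_xOf_eq hz0 hv0 (hz2.trans hv2.symm) with h1 | h1
  · exact hzv h1
  rcases eq_or_eq_neg_of_xOf_eq hz0 hw0 (hz2.trans hw2.symm) with h2 | h2
  · exact hzw h2
  rcases eq_or_eq_neg_of_xOf_eq hv0 hw0 (hv2.trans hw2.symm) with h3 | h3
  · exact hvw h3
  · exact hzw (by rw [h1, h3, neg_neg])

/-- **Vélu's theorem (odd kernel, Kohel's symmetric form): `N = 0`**, i.e.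

  `f·S² = P₂·(U³ + a'·U·P₂² + b'·P₂³)`  in `F[X]`,

so that `(x, y) ↦ (U(x)/P₂(x), y·S(x)/P₂(x)²)` maps `y² = f(x) = x³ + a₄x + a₆` to
`y² = x³ + a'x + b'` (`veluMap_mem` below), where `U/P₂ = x + Σ_{v ≠ O}(x(P+v) - x(v))` and
`yS/P₂² = Σ_{v ∈ G} y(P+v)` are Vélu's functions. Proof: every `x(u)`, `u ∈ G ∖ O`, is a root of
`N` of multiplicity `≥ 10` (`X_sub_C_pow_ten_dvd_veluN`); there are at least `m/2` such values
(`x` is at most `2`-to-`1` on `G ∖ O`), so `deg N ≥ 5m` unless `N = 0` — but `deg N ≤ 4m - 1`.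
[Vélu 1971 (the formulae); Kohel 1996, §2.4; Silverman AEC III.4.12–4.13 (existence and
uniqueness of the separable quotient `E → E/Φ`)] [cite: Velu1971] -/
theorem veluN_eq_zero [CharZero F] {G : Finset (W⁄F).toAffine.Point} (hG : IsOddSubgroupFinset G) :
    veluN G = 0 := by
  by_contra hN
  rcases Nat.eq_zero_or_pos (G.erase 0).card with hm | hm
  · exact hN (veluN_eq_zero_of_erase_eq_empty (Finset.card_eq_zero.mp hm))
  set m := (G.erase 0).card with hmdef
  -- the product over the distinct `x`-coordinates of `G ∖ O` divides `N`
  set R := (G.erase 0).image xOf with hR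
  have hdvd : ∏ a ∈ R, (Polynomial.X - Polynomial.C a) ^ 10 ∣ veluN G := by
    refine Finset.prod_dvd_of_coprime ?_ ?_
    · intro a _ b _ hab
      exact (Polynomial.isCoprime_X_sub_C_of_isUnit_sub (sub_ne_zero.mpr hab).isUnit).pow
    · intro a ha
      obtain ⟨u, hu, rfl⟩ := Finset.mem_image.mp ha
      exact X_sub_C_pow_ten_dvd_veluN hG hN hm hu
  have hdeg₁ : (∏ a ∈ R, (Polynomial.X - Polynomial.C a) ^ 10).natDegree = 10 * R.card := by
    rw [Polynomial.natDegree_prod_of_monic _ _ fun a _ => (Polynomial.monic_X_sub_C a).pow 10]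
    simp [Finset.sum_const, mul_comm]
  have hdeg₂ := Polynomial.natDegree_le_of_dvd hdvd hN
  have hdeg₃ := natDegree_veluN_le hG hm
  have hcard : m ≤ 2 * R.card := Finset.card_le_mul_card_image _ 2 fun a _ => card_filter_xOf_le_two a
  rw [hdeg₁] at hdeg₂
  omega

/-- **Vélu's identity** `f·S² = P₂·(U³ + a'UP₂² + b'P₂³)`. [Vélu 1971; Kohel 1996, §2.4]
[cite: Velu1971] -/
theorem veluF_mul_veluS_sq [CharZero F] {G : Finset (W⁄F).toAffine.Point} (hG : IsOddSubgroupFinset G) :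
    veluF (W⁄F) * veluS G ^ 2 =
      veluP₂ G * (veluU G ^ 3 + Polynomial.C (veluA G) * veluU G * veluP₂ G ^ 2 +
        Polynomial.C (veluB G) * veluP₂ G ^ 3) := by
  have h := veluN_eq_zero hG
  rw [veluN_eq] at h
  exact sub_eq_zero.mp h

/-- **Vélu's isogeny lands on `y² = x³ + a'x + b'`**: for an affine point `P = (x, y)` with
`P₂(x) ≠ 0` (i.e. `P ∉ G`), the point `(U(x)/P₂(x), y·S(x)/P₂(x)²) =
(Σ_{v ∈ G} x(P+v) - Σ_{v ≠ O} x(v), Σ_{v ∈ G} y(P+v))` satisfies `Y² = X³ + a'X + b'`.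
[Vélu 1971 ("la courbe `E/F` … d'équation `y² = x³ + A₄'x + A₆'`")] [cite: Velu1971] -/
theorem veluMap_mem [CharZero F] {G : Finset (W⁄F).toAffine.Point} (hG : IsOddSubgroupFinset G) {x₀ y₀ : F}
    (h₀ : (W⁄F).toAffine.Nonsingular x₀ y₀) (hgood : ∀ v ∈ G.erase 0, xOf v ≠ x₀) :
    (y₀ * (veluS G).eval x₀ / (veluP₂ G).eval x₀ ^ 2) ^ 2 =
      ((veluU G).eval x₀ / (veluP₂ G).eval x₀) ^ 3 + veluA G * ((veluU G).eval x₀ / (veluP₂ G).eval x₀) +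
        veluB G ∧
    (veluU G).eval x₀ / (veluP₂ G).eval x₀ =
      ∑ v ∈ G, xOf (Point.some x₀ y₀ h₀ + v) - ∑ v ∈ G.erase 0, xOf v ∧
    y₀ * (veluS G).eval x₀ / (veluP₂ G).eval x₀ ^ 2 = ∑ v ∈ G, yOf (Point.some x₀ y₀ h₀ + v) := by
  have hp : (veluP₂ G).eval x₀ ≠ 0 := eval_veluP₂_ne_zero hgood
  have hid := congrArg (Polynomial.eval x₀) (veluF_mul_veluS_sq hG)
  simp only [Polynomial.eval_mul, Polynomial.eval_pow, Polynomial.eval_add, Polynomial.eval_C] at hid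
  rw [eval_veluF, ← yOf_sq_eq h₀] at hid
  have hx := veluP₂_mul_sum_xOf hG two_ne_zero h₀ hgood
  have hy := veluP₂_sq_mul_sum_yOf hG two_ne_zero h₀ hgood
  refine ⟨?_, ?_, ?_⟩
  · field_simp
    linear_combination hid
  · rw [div_eq_iff hp, ← hx]; ring
  · rw [div_eq_iff (pow_ne_zero 2 hp), ← hy]; ring

end LaurentPoint

end WeierstrassCurve
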